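import Literature.Geometry.Riemannian.WhiteLocalRegularityCylinderFlow
import Literature.Geometry.Riemannian.FlowC2AlphaNormLSC
import Literature.Geometry.Riemannian.SpacetimeGaussianDensity
import HarnessLib

/-!
# White's local regularity theorem for cylinder flows: reading the `K_{2,α}` bound (proved bricks)

Companion to `WhiteLocalRegularityCylinderFlow.lean`, whose named fact
`White2005_localRegularity_cylinderFlowSheet` (B. White, *A local regularity theorem for mean
curvature flow*, Ann. of Math. 161 (2005) 1487–1519, Thm. 4.1 with Thm. 3.2 and §2.5, single-sheet
form for flows of cross-sections of `S⁴ × ℝ ⊂ ℝ⁶`) concludes, at a top-time point `X = (F t x, t)`,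
(a′) a chordal Lipschitz bound for the unit normal and (b′) a lower area bound
`c r⁴ ≤ μH⁴(M_t ∩ B(F t x, r))`.  In the source these are READ OFF from the bound
`K_{2,α}(𝓜; X) · d(X, U) ≤ C` through the definition of `K_{2,α}` (White 2005, §2.5: after
translating by `-X`, dilating by `λ = K_{2,α}` and rotating, `𝓜 ∩ B^{N,1}` is the graph of ONE
function `u` over the unit ball of an `m`-plane with parabolic `‖u‖_{2,α} ≤ 1`, with equality
`𝓜′ ∩ B^{N,1} = graph(u) ∩ B^{N,1}` for fully regular proper flows, Remark on p. 1494).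

This file PROVES that reading-off step, i.e. everything in the fact downstream of White's
`K_{2,α}` estimate, in the tree's vocabulary.  A **sheet** of a set `S ⊆ ℝ⁶` at `p` of radius `ρ`
is a linear isometry `L : ℝ⁴ → ℝ⁶` and a map `u : ℝ⁴ → ℝ⁶` with `u 0 = 0`, `u ⊥ range L`,
`u` differentiable with `‖Du‖ ≤ 1` (and, for (a′), `Du` `κ`-Lipschitz) on `B(0, ρ)`, such that
`S ∩ B(p, ρ) = {p + L ξ + u ξ : ‖ξ‖ < ρ} ∩ B(p, ρ)` — exactly the time-`t` slice of White's
conclusion (the `C^{1,1}` part of the parabolic `C^{2,α}` information, after undoing the dilation: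
`ρ = 1/λ ≥ d/C`, `κ = λ ≤ C/d`).

## Main results (all sorry-free, no definitions, no named facts)

* `le_hausdorffMeasure_ball_euclideanSpace`, `le_hausdorffMeasure_of_ball_subset_image`: explicit
  lower bounds `(2a)^k ≤ μH[k](B(c, ρ))` (`k a² ≤ ρ²`) for Mathlib's UN-normalised Hausdorff
  measure on `EuclideanSpace ℝ (Fin k)`, and through `1`-Lipschitz maps onto balls (coordinate
  cube + `μH = volume` on `Fin k → ℝ` + `ofLp` is `1`-Lipschitz);
* `le_hausdorffMeasure_inter_ball_of_sheet`: **(b′) on a sheet**, `(r/2)⁴ ≤ μH⁴(S ∩ B(p, r))` for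
  `0 < r ≤ ρ` (the graph over the `r/2`-ball lies in `B(p, r)` and the `1`-Lipschitz chart
  `z ↦ L†(z - p)` maps it onto that ball);
* `sheet_tangent_mem_range_mfderiv`: for an immersion `f : M → ℝ⁶` whose image has a sheet at
  `p`, the range of `df_y` at every `y` with `f y ∈ B(p, ρ)` contains the tangent plane of the
  graph at the parameter of `f y` (chain rule for `f = Φ ∘ L†(· - p) ∘ f` near `y` + dimension
  count);
* `frame_decomposition`, `norm_sub_sq_le_of_frame`, `inner_ne_zero_of_frame`: linear algebra in
  `ℝ⁶` — a unit vector almost orthogonal to a `5`-frame with lower frame bound is close to `±` the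
  unit normal of the frame;
* `sheet_normal_estimate`: **(a′) on a sheet**, for an injective immersion `f` of a compact `M` with
  unit normal field `ν ⊥ df`, `ν ⊥ n ∘ f` for a `1`-Lipschitz field `n` with `n ∘ f ⊥ df`,
  `‖n ∘ f‖ = 1` (for cylinder flows: `n z = (z₀, …, z₄, 0)`, the normal of `S⁴ × ℝ`):
  `‖ν x - ν y‖ ≤ 3(κ+1) ‖f x - f y‖` whenever `‖f x - f y‖ < min(ρ/2, 1/(4(κ+1)))` (sign of `ν`
  fixed by continuity on the connected piece `f⁻¹(Φ(B(0, ρ′)))`);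
* `White2005_localRegularity_cylinderFlowSheet_of_sheets`: the named fact FOLLOWS from White's
  conclusion in sheet form (stated as an explicit hypothesis: sheets of radius `d/C` with
  `κ = C/d` at every point of `M_t` under the fact's density hypothesis).  What remains for
  `…_holds` is exactly White's Theorem 4.1 (parabolic Schauder estimates, Arzelà–Ascoli for
  `C^{2,α}` flows, monotonicity rigidity), which the tree does not have;
* `sheet_eq_of_subset` (White's Remark p. 1494 for compact embedded slices: CONTAINMENT of
  `range f ∩ B(p, ρ)` in the graph already gives equality — star-shaped parameter region,
  inverse function theorem in charts `image_mem_nhds_of_injective_mfderiv`, compactness) and the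
  literal-reading reduction `White2005_localRegularity_cylinderFlowSheet_of_graphs`;
* `exists_graph_of_hasUnitGraphBound`, `White2005_localRegularity_cylinderFlowSheet_of_k2α_bound`:
  the reduction in the tree's OWN `K_{2,α}` vocabulary (`ParabolicFlow.k2α`, `HasUnitGraphBound`
  of `FlowC2AlphaNorm.lean`, with the parabolic `C^{2,α}` norm of `ParabolicHolderNorm.lean`): a
  bound `K_{2,α}(𝓜; (F t x, t)) ≤ C/d` for the spacetime track `𝓜` over `(t - d², t + d²)`
  (White's `K_{2,α}(𝓜; X) d(X, U) ≤ C`) yields the graphs of `…_of_graphs` (time slice of a good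
  scale, mean value inequality for `D u(·, 0)`), hence the fact.  With White's Thm. 2.6–2.8 / 8.1
  for `k2α` proved in `FlowC2AlphaNormLSC.lean`, what remains for `…_holds` is White's Thm. 4.1
  itself in this vocabulary (monotonicity with forcing and its rigidity, the Schauder estimates,
  the blow-up argument); `White2005_localRegularity_cylinderFlowSheet_of_k2αOn_bound` is the same
  reduction from White's printed, scale-invariant form `K_{2,α;U}(𝓜) ≤ C` for the slab
  `U = ℝ⁶ × (t - d², t + d²)` (`ParabolicFlow.k2αOn`, `k2α_le_of_k2αOn_slab_le`);
* `gaussianDensityRatio_track_le_of_densityHypothesis`,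
  `White2005_localRegularity_cylinderFlowSheet_of_whiteForm`: the fact's density hypothesis
  implies White's hypothesis `Θ(𝓜, Y, r) ≤ 1 + ε` (`Y ∈ U`, `0 < r < d(Y, U)`) for the track in the
  slab (`ParabolicFlow.gaussianDensityRatio` of `SpacetimeGaussianDensity.lean`), so the fact
  follows from White's Thm. 4.1 (+ 3.2) stated VERBATIM in the tree's vocabulary for these flows —
  which is exactly what remains for `…_holds`.

## References

* [White2005] B. White, *A local regularity theorem for mean curvature flow*, Ann. of Math. (2)
  161 (2005), 1487–1519: §2.5 (definition of `K_{2,α}`, Remark p. 1494), Thm. 3.1, 3.2, 4.1.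
-/

noncomputable section

open MeasureTheory Metric Set Module
open scoped ENNReal NNReal InnerProductSpace Manifold ContDiff Topology

namespace Literature.Geometry.Riemannian

local notation "E4" => EuclideanSpace ℝ (Fin 4)
local notation "E6" => EuclideanSpace ℝ (Fin 6)

/-! ## Hausdorff measure lower bounds -/

/-- A coordinate cube of half-side `a` with `k a² ≤ ρ²` lies in the Euclidean ball of radius `ρ`.
[folklore] -/
theorem toLp_mem_ball_of_mem_pi_ball {k : ℕ} (hk : 0 < k) (c : EuclideanSpace ℝ (Fin k)) {a ρ : ℝ}
    (hρ : 0 < ρ) (ha : (k : ℝ) * a ^ 2 ≤ ρ ^ 2) {x : Fin k → ℝ}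
    (hx : x ∈ ball (WithLp.ofLp c) a) : WithLp.toLp 2 x ∈ ball c ρ := by
  rw [mem_ball, dist_pi_lt_iff (lt_of_le_of_lt dist_nonneg hx)] at hx
  rw [mem_ball, EuclideanSpace.dist_eq]
  have hkne : (Finset.univ : Finset (Fin k)).Nonempty := Finset.univ_nonempty_iff.2 ⟨⟨0, hk⟩⟩
  have hsum : ∑ i, dist ((WithLp.toLp 2 x) i) (c i) ^ 2 < ρ ^ 2 := by
    calc ∑ i, dist ((WithLp.toLp 2 x) i) (c i) ^ 2 < ∑ _i : Fin k, a ^ 2 := by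
          refine Finset.sum_lt_sum_of_nonempty hkne fun i _ => ?_
          have hi := hx i
          have h0 : 0 ≤ dist (x i) (WithLp.ofLp c i) := dist_nonneg
          simpa using pow_lt_pow_left₀ hi h0 two_ne_zero
      _ = (k : ℝ) * a ^ 2 := by simp
      _ ≤ ρ ^ 2 := ha
  calc √(∑ i, dist ((WithLp.toLp 2 x) i) (c i) ^ 2) < √(ρ ^ 2) :=
        Real.sqrt_lt_sqrt (Finset.sum_nonneg fun i _ => sq_nonneg _) hsum
    _ = ρ := Real.sqrt_sq hρ.le

/-- **Lower bound for the (un-normalised) Hausdorff measure of a Euclidean ball**: if `k a² ≤ ρ²`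
then `(2a)^k ≤ μH[k](B(c, ρ))` in `EuclideanSpace ℝ (Fin k)` (the ball contains the coordinate cube
of side `2a`, on which `μH[k]` is Lebesgue measure for the sup metric, and `ofLp` is `1`-Lipschitz).
[folklore] -/
theorem le_hausdorffMeasure_ball_euclideanSpace {k : ℕ} (hk : 0 < k) (c : EuclideanSpace ℝ (Fin k))
    {a ρ : ℝ} (ha0 : 0 < a) (hρ : 0 < ρ) (ha : (k : ℝ) * a ^ 2 ≤ ρ ^ 2) :
    ENNReal.ofReal ((2 * a) ^ k) ≤ μH[k] (ball c ρ) := by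
  have hL : LipschitzWith 1 (WithLp.ofLp : EuclideanSpace ℝ (Fin k) → (Fin k → ℝ)) :=
    PiLp.lipschitzWith_ofLp 2 _
  have h1 := hL.hausdorffMeasure_image_le (d := (k : ℝ)) (by positivity) (ball c ρ)
  have hsub : ball (WithLp.ofLp c) a ⊆ WithLp.ofLp '' ball c ρ := fun x hx =>
    ⟨WithLp.toLp 2 x, toLp_mem_ball_of_mem_pi_ball hk c hρ ha hx, rfl⟩
  calc ENNReal.ofReal ((2 * a) ^ k)
        = volume (ball (WithLp.ofLp c) a) := by
          rw [Real.volume_pi_ball _ ha0, Fintype.card_fin]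
    _ = μH[k] (ball (WithLp.ofLp c) a) := by
          rw [← hausdorffMeasure_pi_real, Fintype.card_fin]
    _ ≤ μH[k] (WithLp.ofLp '' ball c ρ) := measure_mono hsub
    _ ≤ μH[k] (ball c ρ) := by simpa using h1

/-- **Lower bound for `μH[k]` through a `1`-Lipschitz map onto a Euclidean ball**: if `ψ` is
`1`-Lipschitz on `A` and `ψ '' A ⊇ B(c, ρ) ⊂ ℝᵏ`, then `(2a)^k ≤ μH[k](A)` whenever `k a² ≤ ρ²`.
[folklore] -/
theorem le_hausdorffMeasure_of_ball_subset_image {X : Type*} [EMetricSpace X] [MeasurableSpace X]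
    [BorelSpace X] {k : ℕ} (hk : 0 < k) {ψ : X → EuclideanSpace ℝ (Fin k)} {A : Set X}
    (hψ : LipschitzOnWith 1 ψ A) (c : EuclideanSpace ℝ (Fin k)) {a ρ : ℝ} (ha0 : 0 < a) (hρ : 0 < ρ)
    (ha : (k : ℝ) * a ^ 2 ≤ ρ ^ 2) (hsub : ball c ρ ⊆ ψ '' A) :
    ENNReal.ofReal ((2 * a) ^ k) ≤ μH[k] A := by
  calc ENNReal.ofReal ((2 * a) ^ k) ≤ μH[k] (ball c ρ) :=
        le_hausdorffMeasure_ball_euclideanSpace hk c ha0 hρ ha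
    _ ≤ μH[k] (ψ '' A) := measure_mono hsub
    _ ≤ μH[k] A := by
        simpa using hψ.hausdorffMeasure_image_le (d := (k : ℝ)) (by positivity)

/-- The case used for `4`-dimensional sheets: `ρ⁴ ≤ μH[4](A)` when a `1`-Lipschitz image of `A`
contains a Euclidean `4`-ball of radius `ρ`. [folklore] -/
theorem le_hausdorffMeasure_four_of_ball_subset_image {X : Type*} [EMetricSpace X]
    [MeasurableSpace X] [BorelSpace X] {ψ : X → EuclideanSpace ℝ (Fin 4)} {A : Set X}
    (hψ : LipschitzOnWith 1 ψ A) (c : EuclideanSpace ℝ (Fin 4)) {ρ : ℝ} (hρ : 0 < ρ)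
    (hsub : ball c ρ ⊆ ψ '' A) : ENNReal.ofReal (ρ ^ 4) ≤ μH[4] A := by
  have h := le_hausdorffMeasure_of_ball_subset_image (k := 4) (by norm_num) hψ c (a := ρ / 2)
    (by positivity) hρ (by push_cast; nlinarith) hsub
  have h2 : (2 * (ρ / 2)) ^ 4 = ρ ^ 4 := by ring
  rw [h2] at h
  exact_mod_cast h


/-- The adjoint of a linear isometry is a left inverse. [folklore] -/
theorem adjoint_toContinuousLinearMap_apply_map (L : E4 →ₗᵢ[ℝ] E6) (ξ : E4) :
    ContinuousLinearMap.adjoint L.toContinuousLinearMap (L ξ) = ξ := by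
  refine ext_inner_right ℝ fun η => ?_
  rw [ContinuousLinearMap.adjoint_inner_left]
  simp [LinearIsometry.inner_map_map]

/-- The adjoint of a linear isometry kills vectors orthogonal to its range. [folklore] -/
theorem adjoint_toContinuousLinearMap_apply_eq_zero (L : E4 →ₗᵢ[ℝ] E6) {v : E6}
    (hv : ∀ η, ⟪v, L η⟫_ℝ = 0) : ContinuousLinearMap.adjoint L.toContinuousLinearMap v = 0 := by
  refine ext_inner_right ℝ fun η => ?_
  rw [ContinuousLinearMap.adjoint_inner_left, inner_zero_left]
  exact hv η

/-- The chart `ψ z = L†(z - p)` of a sheet is `1`-Lipschitz. [folklore] -/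
theorem lipschitzWith_adjoint_sub (L : E4 →ₗᵢ[ℝ] E6) (p : E6) :
    LipschitzWith 1 fun z : E6 => ContinuousLinearMap.adjoint L.toContinuousLinearMap (z - p) := by
  refine LipschitzWith.of_dist_le_mul fun z z' => ?_
  rw [dist_eq_norm, dist_eq_norm, ← map_sub, sub_sub_sub_cancel_right, NNReal.coe_one, one_mul]
  calc ‖ContinuousLinearMap.adjoint L.toContinuousLinearMap (z - z')‖
      ≤ ‖ContinuousLinearMap.adjoint L.toContinuousLinearMap‖ * ‖z - z'‖ :=
        ContinuousLinearMap.le_opNorm _ _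
    _ ≤ 1 * ‖z - z'‖ := by
        gcongr
        rw [LinearIsometryEquiv.norm_map]
        exact L.norm_toContinuousLinearMap_le
    _ = ‖z - z'‖ := one_mul _

/-- On a sheet with `u 0 = 0` and `‖Du‖ ≤ 1` on the ball, `‖u ξ‖ ≤ ‖ξ‖`. [folklore] -/
theorem norm_le_of_fderiv_le_one {u : E4 → E6} {ρ : ℝ} (h0 : u 0 = 0)
    (hdiff : ∀ ξ ∈ ball (0 : E4) ρ, DifferentiableAt ℝ u ξ)
    (hD : ∀ ξ ∈ ball (0 : E4) ρ, ‖fderiv ℝ u ξ‖ ≤ 1) {ξ : E4} (hξ : ξ ∈ ball (0 : E4) ρ) :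
    ‖u ξ‖ ≤ ‖ξ‖ := by
  have hρ : 0 < ρ := by
    have := mem_ball.1 hξ; rw [dist_zero_right] at this; exact (norm_nonneg ξ).trans_lt this
  have h := (convex_ball (0 : E4) ρ).norm_image_sub_le_of_norm_fderiv_le hdiff hD
    (mem_ball_self hρ) hξ
  simpa [h0] using h

/-- **Lower area bound on a sheet** (the `(b′)` half of reading White's `K_{2,α}` bound): if
`S ∩ B(p, ρ)` is the part in `B(p, ρ)` of the graph `ξ ↦ p + L ξ + u ξ` over the `ρ`-ball of a
`4`-plane (`L` a linear isometry `ℝ⁴ → ℝ⁶`, `u ⊥ range L`, `u 0 = 0`, `‖Du‖ ≤ 1`), then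
`(r/2)⁴ ≤ μH⁴(S ∩ B(p, r))` for `0 < r ≤ ρ`: the graph over the `r/2`-ball lies in `B(p, r)` and the
`1`-Lipschitz chart `z ↦ L†(z - p)` maps it onto that ball. [cite: White2005, §2.5] -/
theorem le_hausdorffMeasure_inter_ball_of_sheet {S : Set E6} {p : E6} {ρ : ℝ}
    (L : E4 →ₗᵢ[ℝ] E6) {u : E4 → E6} (h0 : u 0 = 0)
    (horth : ∀ ξ ∈ ball (0 : E4) ρ, ∀ η, ⟪u ξ, L η⟫_ℝ = 0)
    (hdiff : ∀ ξ ∈ ball (0 : E4) ρ, DifferentiableAt ℝ u ξ)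
    (hD : ∀ ξ ∈ ball (0 : E4) ρ, ‖fderiv ℝ u ξ‖ ≤ 1)
    (hS : S ∩ ball p ρ = (fun ξ => p + L ξ + u ξ) '' ball (0 : E4) ρ ∩ ball p ρ)
    {r : ℝ} (hr : 0 < r) (hrρ : r ≤ ρ) :
    ENNReal.ofReal ((r / 2) ^ 4) ≤ μH[4] (S ∩ ball p r) := by
  refine le_hausdorffMeasure_four_of_ball_subset_image
    ((lipschitzWith_adjoint_sub L p).lipschitzOnWith) (0 : E4) (by positivity) fun ξ hξ => ?_
  have hξr : ‖ξ‖ < r / 2 := by simpa using hξ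
  have hξρ : ξ ∈ ball (0 : E4) ρ := by
    rw [mem_ball, dist_zero_right]; linarith
  have hmem_ball : p + L ξ + u ξ ∈ ball p r := by
    rw [mem_ball, dist_eq_norm, add_assoc, add_sub_cancel_left]
    calc ‖L ξ + u ξ‖ ≤ ‖L ξ‖ + ‖u ξ‖ := norm_add_le _ _
      _ ≤ ‖ξ‖ + ‖ξ‖ := by
          rw [L.norm_map]; exact add_le_add_right (norm_le_of_fderiv_le_one h0 hdiff hD hξρ) _
      _ < r := by linarith
  have hmemS : p + L ξ + u ξ ∈ S ∩ ball p r := by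
    have : p + L ξ + u ξ ∈ S ∩ ball p ρ := by
      rw [hS]; exact ⟨⟨ξ, hξρ, rfl⟩, ball_subset_ball hrρ hmem_ball⟩
    exact ⟨this.1, hmem_ball⟩
  refine ⟨p + L ξ + u ξ, hmemS, ?_⟩
  simp only [add_assoc, add_sub_cancel_left, map_add, adjoint_toContinuousLinearMap_apply_map,
    adjoint_toContinuousLinearMap_apply_eq_zero L (horth ξ hξρ), add_zero]


/-! ## Tangent planes of a sheet -/

/-- The sheet chart inverts the sheet parametrisation: `L†(L ξ + u ξ) = ξ` when `u ξ ⊥ range L`.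
[folklore] -/
theorem adjoint_apply_sheet (L : E4 →ₗᵢ[ℝ] E6) {u : E4 → E6} {p : E6} {ξ : E4}
    (hξ : ∀ η, ⟪u ξ, L η⟫_ℝ = 0) :
    ContinuousLinearMap.adjoint L.toContinuousLinearMap (p + L ξ + u ξ - p) = ξ := by
  rw [add_assoc, add_sub_cancel_left, map_add, adjoint_toContinuousLinearMap_apply_map]
  -- `map_add` saw `L ξ` through the coercion of `L.toContinuousLinearMap`
  simp [adjoint_toContinuousLinearMap_apply_eq_zero L hξ]

/-- Points of `S` in the sheet ball are sheet points with parameter given by the chart.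
[folklore] -/
theorem exists_param_of_mem_sheet {S : Set E6} {p : E6} {ρ : ℝ} (L : E4 →ₗᵢ[ℝ] E6) {u : E4 → E6}
    (horth : ∀ ξ ∈ ball (0 : E4) ρ, ∀ η, ⟪u ξ, L η⟫_ℝ = 0)
    (hS : S ∩ ball p ρ = (fun ξ => p + L ξ + u ξ) '' ball (0 : E4) ρ ∩ ball p ρ)
    {z : E6} (hzS : z ∈ S) (hz : z ∈ ball p ρ) :
    ContinuousLinearMap.adjoint L.toContinuousLinearMap (z - p) ∈ ball (0 : E4) ρ ∧
      z = p + L (ContinuousLinearMap.adjoint L.toContinuousLinearMap (z - p)) +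
        u (ContinuousLinearMap.adjoint L.toContinuousLinearMap (z - p)) := by
  have hz' : z ∈ S ∩ ball p ρ := ⟨hzS, hz⟩
  rw [hS] at hz'
  obtain ⟨⟨ξ, hξ, rfl⟩, -⟩ := hz'
  rw [adjoint_apply_sheet L (horth ξ hξ)]
  exact ⟨hξ, rfl⟩

/-- **Tangent planes of a sheet** (reading White's `K_{2,α}` bound, tangential part): if the image
of an immersion `f : M → ℝ⁶` meets `B(p, ρ)` exactly in the graph `ξ ↦ p + L ξ + u ξ` over the
`ρ`-ball of a `4`-plane, then at every `y` with `f y ∈ B(p, ρ)` the range of `df_y` IS the tangent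
plane of the graph at the parameter `ξ = L†(f y - p)` of `f y`: it contains `L η + Du(ξ) η` for all
`η`. (Chain rule for `f = Φ ∘ L†(· - p) ∘ f` near `y`, then a dimension count.)
[cite: White2005, §2.5] -/
theorem sheet_tangent_mem_range_mfderiv {M : Type*} [TopologicalSpace M]
    [ChartedSpace E4 M]
    {f : M → E6} (hf : ContMDiff (𝓡 4) (𝓡 6) 1 f)
    (hinj : ∀ y, Function.Injective (mfderiv (𝓡 4) (𝓡 6) f y))
    {p : E6} {ρ : ℝ} (L : E4 →ₗᵢ[ℝ] E6) {u : E4 → E6}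
    (horth : ∀ ξ ∈ ball (0 : E4) ρ, ∀ η, ⟪u ξ, L η⟫_ℝ = 0)
    (hdiff : ∀ ξ ∈ ball (0 : E4) ρ, DifferentiableAt ℝ u ξ)
    (hS : Set.range f ∩ ball p ρ = (fun ξ => p + L ξ + u ξ) '' ball (0 : E4) ρ ∩ ball p ρ)
    {y : M} (hy : f y ∈ ball p ρ) (η : E4) :
    ∃ w : E4, mfderiv (𝓡 4) (𝓡 6) f y w =
      (L η + fderiv ℝ u (ContinuousLinearMap.adjoint L.toContinuousLinearMap (f y - p)) η :
        E6) := by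
  set A : E6 →L[ℝ] E4 := ContinuousLinearMap.adjoint L.toContinuousLinearMap with hA
  set Φ : E4 → E6 := fun ξ => p + L ξ + u ξ with hΦ
  set ξ : E4 := A (f y - p) with hξdef
  obtain ⟨hξ, hfy⟩ := exists_param_of_mem_sheet L horth hS (mem_range_self y) hy
  -- `f = Φ ∘ ψ ∘ f` near `y`
  have hev : f =ᶠ[𝓝 y] (fun z : E6 => Φ (A (z - p))) ∘ f := by
    have hV : f ⁻¹' ball p ρ ∈ 𝓝 y := (hf.continuous.isOpen_preimage _ isOpen_ball).mem_nhds hy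
    filter_upwards [hV] with y' hy'
    exact (exists_param_of_mem_sheet L horth hS (mem_range_self y') hy').2
  -- derivative of `Φ ∘ ψ` at `f y`
  have hΦd : HasFDerivAt Φ (L.toContinuousLinearMap + fderiv ℝ u ξ) ξ := by
    have h1 : HasFDerivAt (fun ξ' : E4 => p + L ξ') L.toContinuousLinearMap ξ :=
      (L.toContinuousLinearMap.hasFDerivAt).const_add p
    exact h1.add (hdiff ξ hξ).hasFDerivAt
  have hψd : HasFDerivAt (fun z : E6 => A (z - p)) A (f y) := by
    have h := (A.hasFDerivAt (x := f y - p)).comp (f y) ((hasFDerivAt_id (f y)).sub_const p)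
    simpa [Function.comp_def] using h
  have hcomp : HasFDerivAt (fun z : E6 => Φ (A (z - p)))
      ((L.toContinuousLinearMap + fderiv ℝ u ξ).comp A) (f y) := by
    have := hΦd
    rw [hξdef] at this
    exact this.comp (f y) hψd
  -- manifold chain rule and uniqueness of the derivative
  have hfd : HasMFDerivAt (𝓡 4) (𝓡 6) f y (mfderiv (𝓡 4) (𝓡 6) f y) :=
    (hf.mdifferentiableAt one_ne_zero).hasMFDerivAt
  have hchain : HasMFDerivAt (𝓡 4) (𝓡 6) ((fun z : E6 => Φ (A (z - p))) ∘ f) y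
      (((L.toContinuousLinearMap + fderiv ℝ u ξ).comp A).comp (mfderiv (𝓡 4) (𝓡 6) f y)) :=
    hcomp.hasMFDerivAt.comp y hfd
  have heq : mfderiv (𝓡 4) (𝓡 6) f y =
      ((L.toContinuousLinearMap + fderiv ℝ u ξ).comp A).comp (mfderiv (𝓡 4) (𝓡 6) f y) :=
    (hchain.congr_of_eventuallyEq hev).mfderiv
  -- dimension count
  set Df : E4 →L[ℝ] E6 := mfderiv (𝓡 4) (𝓡 6) f y with hDf
  set T : E4 →L[ℝ] E6 := L.toContinuousLinearMap + fderiv ℝ u ξ with hT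
  have heq' : Df = (T.comp A).comp Df := heq
  set R₁ : Submodule ℝ E6 := LinearMap.range (Df : E4 →ₗ[ℝ] E6) with hR₁
  set R₂ : Submodule ℝ E6 := LinearMap.range (T : E4 →ₗ[ℝ] E6) with hR₂
  have hle : R₁ ≤ R₂ := by
    rintro v ⟨w, rfl⟩
    refine ⟨A (Df w), ?_⟩
    change T (A (Df w)) = Df w
    conv_rhs => rw [heq']
    rfl
  have hinj' : Function.Injective (Df : E4 →ₗ[ℝ] E6) := hinj y
  have h1 : finrank ℝ R₁ = 4 := by
    have := LinearMap.finrank_range_of_inj hinj'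
    simpa using this
  have h2 : finrank ℝ R₂ ≤ 4 := by
    simpa using LinearMap.finrank_range_le (T : E4 →ₗ[ℝ] E6)
  have hR : R₁ = R₂ := Submodule.eq_of_le_of_finrank_le hle (by omega)
  have hmem : (T η : E6) ∈ R₁ := by rw [hR]; exact ⟨η, rfl⟩
  obtain ⟨w, hw⟩ := hmem
  refine ⟨w, ?_⟩
  change (Df w : E6) = _
  have hw' : Df w = T η := hw
  rw [hw', hT]
  rfl


/-! ## Linear algebra: frames in `ℝ⁶` -/


/-- **Frame decomposition in `ℝ⁶`.** If `fr₀, …, fr₄` is a frame with lower bound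
`∑ cᵢ² ≤ ‖∑ cᵢ frᵢ‖²` and the unit vector `νx` is orthogonal to it, then every unit vector `νy`
splits as `νy = ⟪νx, νy⟫ νx + w` with `w` in the span of the frame, `⟪νx,νy⟫² + ‖w‖² = 1`, and
`‖w‖² ≤ ∑ ⟪νy, frᵢ⟫²` (the frame coefficients of `w` are controlled by the lower frame bound).
[folklore] -/
theorem frame_decomposition {fr : Fin 5 → E6}
    (hfr : ∀ c : Fin 5 → ℝ, ∑ i, c i ^ 2 ≤ ‖∑ i, c i • fr i‖ ^ 2)
    {νx νy : E6} (hx1 : ‖νx‖ = 1) (hy1 : ‖νy‖ = 1) (hxfr : ∀ i, ⟪νx, fr i⟫_ℝ = 0) :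
    ⟪νx, νy⟫_ℝ ^ 2 + ‖νy - ⟪νx, νy⟫_ℝ • νx‖ ^ 2 = 1 ∧
      ‖νy - ⟪νx, νy⟫_ℝ • νx‖ ^ 2 ≤ ∑ i, ⟪νy, fr i⟫_ℝ ^ 2 := by
  set a : ℝ := ⟪νx, νy⟫_ℝ with ha
  set w : E6 := νy - a • νx with hw
  have hxne : νx ≠ 0 := by
    intro h; rw [h, norm_zero] at hx1; exact zero_ne_one hx1
  -- `w ⊥ νx`
  have hxw : ⟪νx, w⟫_ℝ = 0 := by
    rw [hw, inner_sub_right, inner_smul_right, real_inner_self_eq_norm_sq, hx1]; ring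
  -- Pythagoras: `1 = a² + ‖w‖²`
  have hpyth : a ^ 2 + ‖w‖ ^ 2 = 1 := by
    have hνy : νy = a • νx + w := by rw [hw]; abel
    have h := norm_add_sq_real (a • νx) w
    rw [← hνy, hy1, inner_smul_left, hxw, norm_smul, Real.norm_eq_abs, hx1] at h
    simp only [one_pow, RCLike.conj_to_real, mul_zero, add_zero, mul_one, sq_abs] at h
    linarith [h]
  refine ⟨hpyth, ?_⟩
  -- the frame spans a `5`-space `W` with `Wᗮ = ℝ ∙ νx`, so `w ∈ W`
  have hli : LinearIndependent ℝ fr := by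
    rw [Fintype.linearIndependent_iff]
    intro c hc i
    have h := hfr c
    rw [hc, norm_zero, zero_pow two_ne_zero] at h
    have h' : ∑ j, c j ^ 2 = 0 := le_antisymm h (Finset.sum_nonneg fun j _ => sq_nonneg _)
    have := (Finset.sum_eq_zero_iff_of_nonneg fun j _ => sq_nonneg (c j)).1 h' i (Finset.mem_univ _)
    exact pow_eq_zero_iff two_ne_zero |>.1 this
  set W : Submodule ℝ E6 := Submodule.span ℝ (Set.range fr) with hW
  have hW5 : finrank ℝ W = 5 := by
    rw [hW, finrank_span_eq_card hli, Fintype.card_fin]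
  have hWo1 : finrank ℝ Wᗮ = 1 := by
    have h := Submodule.finrank_add_finrank_orthogonal W
    rw [hW5, finrank_euclideanSpace_fin] at h
    omega
  have hle : (ℝ ∙ νx) ≤ Wᗮ := by
    have h1 : W ≤ (ℝ ∙ νx)ᗮ := by
      rw [hW, Submodule.span_le]
      rintro _ ⟨i, rfl⟩
      exact (Submodule.mem_orthogonal_singleton_iff_inner_right).2 (hxfr i)
    exact (Submodule.le_orthogonal_orthogonal _).trans (Submodule.orthogonal_le h1)
  have hWo : (ℝ ∙ νx) = Wᗮ :=
    Submodule.eq_of_le_of_finrank_eq hle (by rw [hWo1, finrank_span_singleton hxne])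
  have hwW : w ∈ W := by
    rw [← Submodule.orthogonal_orthogonal W, ← hWo]
    exact (Submodule.mem_orthogonal_singleton_iff_inner_right).2 hxw
  -- coefficients of `w` in the frame
  obtain ⟨c, hc⟩ := (Submodule.mem_span_range_iff_exists_fun ℝ).1 hwW
  have hww : ‖w‖ ^ 2 = ∑ i, c i * ⟪νy, fr i⟫_ℝ := by
    rw [← real_inner_self_eq_norm_sq]
    conv_lhs => rhs; rw [← hc]
    rw [hw, inner_sub_left, inner_sum, inner_sum]
    simp [inner_smul_right, inner_smul_left, hxfr]
  have hcs : (∑ i, c i * ⟪νy, fr i⟫_ℝ) ^ 2 ≤ (∑ i, c i ^ 2) * ∑ i, ⟪νy, fr i⟫_ℝ ^ 2 :=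
    Finset.sum_mul_sq_le_sq_mul_sq _ _ _
  have hcw : ∑ i, c i ^ 2 ≤ ‖w‖ ^ 2 := by rw [← hc]; exact hfr c
  -- `‖w‖⁴ ≤ ‖w‖² · ∑ ⟪νy, frᵢ⟫²`
  have hS0 : 0 ≤ ∑ i, ⟪νy, fr i⟫_ℝ ^ 2 := Finset.sum_nonneg fun i _ => sq_nonneg _
  by_cases hw0 : ‖w‖ ^ 2 = 0
  · rw [hw0]; exact hS0
  · have hpos : 0 < ‖w‖ ^ 2 := lt_of_le_of_ne (sq_nonneg _) (Ne.symm hw0)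
    have h4 : (‖w‖ ^ 2) ^ 2 ≤ ‖w‖ ^ 2 * ∑ i, ⟪νy, fr i⟫_ℝ ^ 2 := by
      calc (‖w‖ ^ 2) ^ 2 = (∑ i, c i * ⟪νy, fr i⟫_ℝ) ^ 2 := by rw [hww]
        _ ≤ (∑ i, c i ^ 2) * ∑ i, ⟪νy, fr i⟫_ℝ ^ 2 := hcs
        _ ≤ ‖w‖ ^ 2 * ∑ i, ⟪νy, fr i⟫_ℝ ^ 2 := by gcongr
    exact le_of_mul_le_mul_left (by nlinarith [h4]) hpos

/-- With a frame as in `frame_decomposition`: if `∑ ⟪νy, frᵢ⟫² < 1` then `⟪νx, νy⟫ ≠ 0`.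
[folklore] -/
theorem inner_ne_zero_of_frame {fr : Fin 5 → E6}
    (hfr : ∀ c : Fin 5 → ℝ, ∑ i, c i ^ 2 ≤ ‖∑ i, c i • fr i‖ ^ 2)
    {νx νy : E6} (hx1 : ‖νx‖ = 1) (hy1 : ‖νy‖ = 1) (hxfr : ∀ i, ⟪νx, fr i⟫_ℝ = 0)
    (hsmall : ∑ i, ⟪νy, fr i⟫_ℝ ^ 2 < 1) : ⟪νx, νy⟫_ℝ ≠ 0 := by
  obtain ⟨h1, h2⟩ := frame_decomposition hfr hx1 hy1 hxfr
  intro h0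
  rw [h0] at h1 h2
  nlinarith

/-- With a frame as in `frame_decomposition`: if `⟪νx, νy⟫ ≥ 0` then
`‖νy - νx‖² ≤ 2 ∑ ⟪νy, frᵢ⟫²`. [folklore] -/
theorem norm_sub_sq_le_of_frame {fr : Fin 5 → E6}
    (hfr : ∀ c : Fin 5 → ℝ, ∑ i, c i ^ 2 ≤ ‖∑ i, c i • fr i‖ ^ 2)
    {νx νy : E6} (hx1 : ‖νx‖ = 1) (hy1 : ‖νy‖ = 1) (hxfr : ∀ i, ⟪νx, fr i⟫_ℝ = 0)
    (hpos : 0 ≤ ⟪νx, νy⟫_ℝ) : ‖νy - νx‖ ^ 2 ≤ 2 * ∑ i, ⟪νy, fr i⟫_ℝ ^ 2 := by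
  obtain ⟨h1, h2⟩ := frame_decomposition hfr hx1 hy1 hxfr
  have ha1 : ⟪νx, νy⟫_ℝ ≤ 1 := by nlinarith [norm_nonneg (νy - ⟪νx, νy⟫_ℝ • νx)]
  have hdist : ‖νy - νx‖ ^ 2 = 2 - 2 * ⟪νx, νy⟫_ℝ := by
    rw [← real_inner_self_eq_norm_sq, inner_sub_left, inner_sub_right, inner_sub_right,
      real_inner_self_eq_norm_sq, real_inner_self_eq_norm_sq, hx1, hy1, real_inner_comm νx νy]
    ring
  rw [hdist]
  nlinarith [h1, h2]


/-! ## The normal estimate on a sheet -/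


/-- On a sheet, the derivative of `u` is orthogonal to the plane: `⟪Du(ξ) v, L η⟫ = 0`
(differentiate the identity `⟪u ·, L η⟫ ≡ 0` on the ball). [folklore] -/
theorem inner_fderiv_sheet_eq_zero {ρ : ℝ} (L : E4 →ₗᵢ[ℝ] E6) {u : E4 → E6}
    (horth : ∀ ξ ∈ ball (0 : E4) ρ, ∀ η, ⟪u ξ, L η⟫_ℝ = 0)
    (hdiff : ∀ ξ ∈ ball (0 : E4) ρ, DifferentiableAt ℝ u ξ)
    {ξ : E4} (hξ : ξ ∈ ball (0 : E4) ρ) (v η : E4) : ⟪fderiv ℝ u ξ v, L η⟫_ℝ = 0 := by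
  -- `g := ⟪L η, u ·⟫` has derivative `⟪L η, Du(ξ) ·⟫` and is `0` near `ξ`
  have hg : HasFDerivAt (fun ξ' => ⟪L η, u ξ'⟫_ℝ) ((innerSL ℝ (L η)).comp (fderiv ℝ u ξ)) ξ :=
    (innerSL ℝ (L η)).hasFDerivAt.comp ξ (hdiff ξ hξ).hasFDerivAt
  have hg0 : HasFDerivAt (fun ξ' => ⟪L η, u ξ'⟫_ℝ) (0 : E4 →L[ℝ] ℝ) ξ := by
    refine (hasFDerivAt_const (0 : ℝ) ξ).congr_of_eventuallyEq ?_
    filter_upwards [isOpen_ball.mem_nhds hξ] with ξ' hξ'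
    rw [real_inner_comm]
    exact horth ξ' hξ' η
  have h := congrArg (fun T : E4 →L[ℝ] ℝ => T v) (hg.unique hg0)
  simp only [ContinuousLinearMap.coe_comp, Function.comp_apply, innerSL_apply_apply,
    zero_apply] at h
  rwa [real_inner_comm] at h

/-- **Lower frame bound of a sheet frame.** For the frame `(L e₀ + Du(0) e₀, …, L e₃ + Du(0) e₃, n)`
of a sheet (`Du(0) eᵢ ⊥ range L`, `n` a unit vector orthogonal to the four tangent vectors),
`∑ cᵢ² ≤ ‖∑ cᵢ frᵢ‖²`. [folklore] -/
theorem sheet_frame_lower_bound (L : E4 →ₗᵢ[ℝ] E6) (D : E4 →L[ℝ] E6)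
    (hD : ∀ v η : E4, ⟪D v, L η⟫_ℝ = 0) {n : E6} (hn1 : ‖n‖ = 1)
    (hnt : ∀ v : E4, ⟪n, L v + D v⟫_ℝ = 0) (c : Fin 5 → ℝ) :
    ∑ i, c i ^ 2 ≤
      ‖∑ i, c i • (Fin.snoc (fun j : Fin 4 => (L (EuclideanSpace.single j (1 : ℝ)) +
        D (EuclideanSpace.single j (1 : ℝ)) : E6)) n : Fin 5 → E6) i‖ ^ 2 := by
  -- the tangential coefficient vector
  set c' : E4 := ∑ j : Fin 4, c (Fin.castSucc j) • EuclideanSpace.single j (1 : ℝ) with hc'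
  have hsum : ∑ i, c i • (Fin.snoc (fun j : Fin 4 => (L (EuclideanSpace.single j (1 : ℝ)) +
        D (EuclideanSpace.single j (1 : ℝ)) : E6)) n : Fin 5 → E6) i =
        (L c' + D c') + c (Fin.last 4) • n := by
    rw [Fin.sum_univ_castSucc]
    simp only [Fin.snoc_castSucc, Fin.snoc_last, hc', map_sum, map_smul, smul_add,
      Finset.sum_add_distrib]
  have hc'n : ‖c'‖ ^ 2 = ∑ j : Fin 4, c (Fin.castSucc j) ^ 2 := by
    rw [hc', EuclideanSpace.norm_sq_eq]
    congr 1; ext j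
    simp [Finset.sum_apply, Pi.single_apply, Real.norm_eq_abs, sq_abs]
  have horth1 : ⟪L c', D c'⟫_ℝ = 0 := by rw [real_inner_comm]; exact hD c' c'
  have horth2 : ⟪L c' + D c', n⟫_ℝ = 0 := by rw [real_inner_comm]; exact hnt c'
  have h1 : ‖L c' + D c'‖ ^ 2 = ‖c'‖ ^ 2 + ‖D c'‖ ^ 2 := by
    rw [norm_add_sq_real, horth1, L.norm_map]; ring
  have h2 : ‖(L c' + D c') + c (Fin.last 4) • n‖ ^ 2 = ‖L c' + D c'‖ ^ 2 + c (Fin.last 4) ^ 2 := by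
    rw [norm_add_sq_real, inner_smul_right, horth2, norm_smul, Real.norm_eq_abs, hn1]
    simp [sq_abs]
  rw [hsum, h2, h1, hc'n, Fin.sum_univ_castSucc]
  nlinarith [sq_nonneg ‖D c'‖]



/-- The sheet chart is norm-non-increasing: `‖L† v‖ ≤ ‖v‖`. [folklore] -/
theorem norm_adjoint_apply_le (L : E4 →ₗᵢ[ℝ] E6) (v : E6) :
    ‖ContinuousLinearMap.adjoint L.toContinuousLinearMap v‖ ≤ ‖v‖ := by
  calc ‖ContinuousLinearMap.adjoint L.toContinuousLinearMap v‖
      ≤ ‖ContinuousLinearMap.adjoint L.toContinuousLinearMap‖ * ‖v‖ :=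
        ContinuousLinearMap.le_opNorm _ _
    _ ≤ 1 * ‖v‖ := by
        gcongr
        rw [LinearIsometryEquiv.norm_map]
        exact L.norm_toContinuousLinearMap_le
    _ = ‖v‖ := one_mul _

/-- The almost-orthogonality of a nearby normal to the centre frame of a sheet: if `ν′` is a unit
vector orthogonal to the graph's tangent plane `L + D′` at a nearby parameter and to a vector `m`
(the ambient field at the nearby point), where `‖D₀ - D′‖ ≤ κ a` and `‖nₚ - m‖ ≤ a`, then
`∑ᵢ ⟪ν′, frᵢ⟫² ≤ (4κ² + 1) a²` for the centre frame `fr = (L eⱼ + D₀ eⱼ)ⱼ, nₚ`. [folklore] -/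
theorem sheet_frame_inner_sq_sum_le (L : E4 →ₗᵢ[ℝ] E6) (D0 D' : E4 →L[ℝ] E6) {np m ν' : E6}
    {κ a : ℝ} (hν1 : ‖ν'‖ = 1)
    (hνtan : ∀ η : E4, ⟪ν', L η + D' η⟫_ℝ = 0) (hνm : ⟪ν', m⟫_ℝ = 0)
    (hD : ‖D0 - D'‖ ≤ κ * a) (hm : ‖np - m‖ ≤ a) :
    ∑ i, ⟪ν', (Fin.snoc (fun j : Fin 4 => (L (EuclideanSpace.single j (1 : ℝ)) +
        D0 (EuclideanSpace.single j (1 : ℝ)) : E6)) np : Fin 5 → E6) i⟫_ℝ ^ 2 ≤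
      (4 * κ ^ 2 + 1) * a ^ 2 := by
  -- tangential terms
  have ht : ∀ j : Fin 4,
      ⟪ν', L (EuclideanSpace.single j (1 : ℝ)) + D0 (EuclideanSpace.single j (1 : ℝ))⟫_ℝ ^ 2 ≤
        (κ * a) ^ 2 := by
    intro j
    have e1 : ‖(EuclideanSpace.single j (1 : ℝ) : E4)‖ = 1 := by simp
    have hrw : ⟪ν', L (EuclideanSpace.single j (1 : ℝ)) + D0 (EuclideanSpace.single j (1 : ℝ))⟫_ℝ =
        ⟪ν', (D0 - D') (EuclideanSpace.single j 1)⟫_ℝ := by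
      have h := hνtan (EuclideanSpace.single j 1)
      rw [inner_add_right] at h
      rw [_root_.sub_apply, inner_sub_right, inner_add_right]
      linarith
    rw [hrw]
    have hb : |⟪ν', (D0 - D') (EuclideanSpace.single j 1)⟫_ℝ| ≤ κ * a := by
      calc |⟪ν', (D0 - D') (EuclideanSpace.single j 1)⟫_ℝ|
          ≤ ‖ν'‖ * ‖(D0 - D') (EuclideanSpace.single j 1)‖ := abs_real_inner_le_norm _ _
        _ ≤ 1 * (‖D0 - D'‖ * ‖(EuclideanSpace.single j (1 : ℝ) : E4)‖) := by
            rw [hν1]; gcongr; exact ContinuousLinearMap.le_opNorm _ _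
        _ ≤ κ * a := by rw [one_mul, e1, mul_one]; exact hD
    exact sq_le_sq.2 (hb.trans (le_abs_self _))
  -- normal term
  have hn' : ⟪ν', np⟫_ℝ ^ 2 ≤ a ^ 2 := by
    have hrw : ⟪ν', np⟫_ℝ = ⟪ν', np - m⟫_ℝ := by rw [inner_sub_right, hνm, sub_zero]
    rw [hrw]
    have hb : |⟪ν', np - m⟫_ℝ| ≤ a := by
      calc |⟪ν', np - m⟫_ℝ| ≤ ‖ν'‖ * ‖np - m‖ := abs_real_inner_le_norm _ _
        _ ≤ 1 * a := by rw [hν1]; gcongr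
        _ = a := one_mul a
    exact sq_le_sq.2 (hb.trans (le_abs_self _))
  rw [Fin.sum_univ_castSucc]
  simp only [Fin.snoc_castSucc, Fin.snoc_last]
  have hsum4 : ∑ j : Fin 4, ⟪ν', L (EuclideanSpace.single j (1 : ℝ)) +
      D0 (EuclideanSpace.single j (1 : ℝ))⟫_ℝ ^ 2 ≤ 4 * (κ * a) ^ 2 := by
    calc ∑ j : Fin 4, ⟪ν', L (EuclideanSpace.single j (1 : ℝ)) +
          D0 (EuclideanSpace.single j (1 : ℝ))⟫_ℝ ^ 2 ≤ ∑ _j : Fin 4, (κ * a) ^ 2 :=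
          Finset.sum_le_sum fun j _ => ht j
      _ = 4 * (κ * a) ^ 2 := by simp
  have : 4 * (κ * a) ^ 2 + a ^ 2 = (4 * κ ^ 2 + 1) * a ^ 2 := by ring
  linarith only [hsum4, hn', this]

/-- **The normal estimate on a sheet** (the `(a′)` half of reading White's `K_{2,α}` bound).
Let `f : M → ℝ⁶` be an injective `C¹` immersion of a compact manifold whose image has a sheet
`(L, u)` of radius `ρ` at `p = f x` with `Du` `κ`-Lipschitz on the ball, let `ν` be a continuous
unit normal field (`ν y ⊥ df_y`) and `n` a `1`-Lipschitz field on `ℝ⁶` with `‖n (f y)‖ = 1`,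
`n (f y) ⊥ df_y` and `ν y ⊥ n (f y)` (for cross-sections of `S⁴ × ℝ`: `n z = (z₀,…,z₄,0)`).  Then
`‖ν x - ν y‖ ≤ 3(κ+1) ‖f x - f y‖` whenever `‖f x - f y‖ < min(ρ/2, 1/(4(κ+1)))`.  Proof: the frame
`(L eⱼ + Du(0) eⱼ)ⱼ, n p` at `x` has lower frame bound `1` and `ν x ⊥` it; `ν y` is orthogonal to
the frame at the parameter `ξ` of `f y`, which differs from the frame at `x` by `≤ κ‖ξ‖`
(tangential part) and `≤ ‖f y - p‖` (normal part); so `ν y = ±ν x + O((κ+1)‖f x - f y‖)`, and the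
sign is `+` by continuity of `⟪ν x, ν ·⟫` on the connected piece `f⁻¹(Φ(B(0, ρ′)))`, on which it
does not vanish. [cite: White2005, §2.5] -/
theorem sheet_normal_estimate {M : Type*} [TopologicalSpace M] [CompactSpace M]
    [ChartedSpace E4 M]
    {f : M → E6} (hf : ContMDiff (𝓡 4) (𝓡 6) 1 f) (hfinj : Function.Injective f)
    (hinj : ∀ y, Function.Injective (mfderiv (𝓡 4) (𝓡 6) f y))
    {ν : M → E6} (hνc : Continuous ν) (hν1 : ∀ y, ‖ν y‖ = 1)
    (hνt : ∀ y (v : E4), ⟪ν y, mfderiv (𝓡 4) (𝓡 6) f y v⟫_ℝ = 0)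
    {n : E6 → E6} (hnlip : ∀ z z', ‖n z - n z'‖ ≤ ‖z - z'‖) (hn1 : ∀ y, ‖n (f y)‖ = 1)
    (hνn : ∀ y, ⟪ν y, n (f y)⟫_ℝ = 0)
    (hnt : ∀ y (v : E4), ⟪n (f y), mfderiv (𝓡 4) (𝓡 6) f y v⟫_ℝ = 0)
    {x : M} {ρ κ : ℝ} (hκ : 0 ≤ κ) (L : E4 →ₗᵢ[ℝ] E6) {u : E4 → E6} (h0 : u 0 = 0)
    (horth : ∀ ξ ∈ ball (0 : E4) ρ, ∀ η, ⟪u ξ, L η⟫_ℝ = 0)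
    (hdiff : ∀ ξ ∈ ball (0 : E4) ρ, DifferentiableAt ℝ u ξ)
    (hD : ∀ ξ ∈ ball (0 : E4) ρ, ‖fderiv ℝ u ξ‖ ≤ 1)
    (hD2 : ∀ ξ ∈ ball (0 : E4) ρ, ∀ ξ' ∈ ball (0 : E4) ρ,
      ‖fderiv ℝ u ξ - fderiv ℝ u ξ'‖ ≤ κ * ‖ξ - ξ'‖)
    (hS : Set.range f ∩ ball (f x) ρ =
      (fun ξ => f x + L ξ + u ξ) '' ball (0 : E4) ρ ∩ ball (f x) ρ)
    {y : M} (hy : ‖f x - f y‖ < min (ρ / 2) (1 / (4 * (κ + 1)))) :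
    ‖ν x - ν y‖ ≤ 3 * (κ + 1) * ‖f x - f y‖ := by
  -- notation and elementary bounds
  set p : E6 := f x with hp
  set A : E6 →L[ℝ] E4 := ContinuousLinearMap.adjoint L.toContinuousLinearMap with hA
  set Φ : E4 → E6 := fun ξ => p + L ξ + u ξ with hΦ
  set ρ' : ℝ := min (ρ / 2) (1 / (4 * (κ + 1))) with hρ'
  have hρ'pos : 0 < ρ' := lt_of_le_of_lt (norm_nonneg _) hy
  have hρ'ρ2 : ρ' ≤ ρ / 2 := min_le_left _ _
  have hρ'κ : ρ' ≤ 1 / (4 * (κ + 1)) := min_le_right _ _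
  have hρ : 0 < ρ := by linarith
  have hκ1 : 0 < κ + 1 := by linarith
  have hρ'κ' : ρ' * (4 * (κ + 1)) ≤ 1 := by
    rwa [le_div_iff₀ (by positivity)] at hρ'κ
  have hball : ball (0 : E4) ρ' ⊆ ball (0 : E4) ρ := ball_subset_ball (by linarith)
  -- `‖Φ ξ - p‖ ≤ 2‖ξ‖`
  have hΦp : ∀ ξ ∈ ball (0 : E4) ρ, ‖Φ ξ - p‖ ≤ 2 * ‖ξ‖ := by
    intro ξ hξ
    have : Φ ξ - p = L ξ + u ξ := by simp only [hΦ]; abel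
    rw [this]
    calc ‖L ξ + u ξ‖ ≤ ‖L ξ‖ + ‖u ξ‖ := norm_add_le _ _
      _ ≤ ‖ξ‖ + ‖ξ‖ := by
          rw [L.norm_map]; exact add_le_add_right (norm_le_of_fderiv_le_one h0 hdiff hD hξ) _
      _ = 2 * ‖ξ‖ := by ring
  have hΦball : ∀ ξ ∈ ball (0 : E4) ρ', Φ ξ ∈ ball p ρ := by
    intro ξ hξ
    rw [mem_ball, dist_eq_norm]
    have hξ' : ‖ξ‖ < ρ' := by simpa using hξ
    calc ‖Φ ξ - p‖ ≤ 2 * ‖ξ‖ := hΦp ξ (hball hξ)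
      _ < ρ := by linarith
  have hΦrange : Φ '' ball (0 : E4) ρ' ⊆ Set.range f := by
    rintro _ ⟨ξ, hξ, rfl⟩
    have : Φ ξ ∈ Set.range f ∩ ball p ρ := by
      rw [hS]; exact ⟨⟨ξ, hball hξ, rfl⟩, hΦball ξ hξ⟩
    exact this.1
  -- parameters of points of the sheet ball
  have hpar : ∀ y', f y' ∈ ball p ρ → A (f y' - p) ∈ ball (0 : E4) ρ ∧ f y' = Φ (A (f y' - p)) :=
    fun y' hy' => exists_param_of_mem_sheet L horth hS (mem_range_self y') hy'
  have hAnorm : ∀ y', ‖A (f y' - p)‖ ≤ ‖f y' - p‖ := fun y' => norm_adjoint_apply_le L _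
  -- `ν y'` and `n (f y')` are orthogonal to the tangent plane of the graph at the parameter
  have hνtan : ∀ y', f y' ∈ ball p ρ → ∀ η : E4,
      ⟪ν y', L η + fderiv ℝ u (A (f y' - p)) η⟫_ℝ = 0 := by
    intro y' hy' η
    obtain ⟨w, hw⟩ := sheet_tangent_mem_range_mfderiv hf hinj L horth hdiff hS hy' η
    rw [← hw]; exact hνt y' w
  have hntan : ∀ y', f y' ∈ ball p ρ → ∀ η : E4,
      ⟪n (f y'), L η + fderiv ℝ u (A (f y' - p)) η⟫_ℝ = 0 := by
    intro y' hy' η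
    obtain ⟨w, hw⟩ := sheet_tangent_mem_range_mfderiv hf hinj L horth hdiff hS hy' η
    rw [← hw]; exact hnt y' w
  -- at the centre
  have hx0 : A (f x - p) = 0 := by simp [hp]
  have hxball : f x ∈ ball p ρ := by simpa [hp] using hρ
  -- the frame at `x`
  set D0 : E4 →L[ℝ] E6 := fderiv ℝ u 0 with hD0
  set fr : Fin 5 → E6 := Fin.snoc (fun j : Fin 4 => (L (EuclideanSpace.single j (1 : ℝ)) +
      D0 (EuclideanSpace.single j (1 : ℝ)) : E6)) (n p) with hfrdef
  have hfr : ∀ c : Fin 5 → ℝ, ∑ i, c i ^ 2 ≤ ‖∑ i, c i • fr i‖ ^ 2 := by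
    refine sheet_frame_lower_bound L D0
      (fun v η => inner_fderiv_sheet_eq_zero L horth hdiff (mem_ball_self hρ) v η) (hn1 x) ?_
    intro v
    have h := hntan x hxball v
    rwa [hx0] at h
  have hνxfr : ∀ i, ⟪ν x, fr i⟫_ℝ = 0 := by
    intro i
    refine Fin.lastCases ?_ (fun j => ?_) i
    · simp only [hfrdef, Fin.snoc_last]
      exact hνn x
    · simp only [hfrdef, Fin.snoc_castSucc]
      have h := hνtan x hxball (EuclideanSpace.single j 1)
      rwa [hx0] at h
  -- the key bound: `∑ ⟪ν y', frᵢ⟫² ≤ (4κ² + 1) ‖f y' - p‖²` on the sheet ball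
  have hδ : ∀ y', f y' ∈ ball p ρ →
      ∑ i, ⟪ν y', fr i⟫_ℝ ^ 2 ≤ (4 * κ ^ 2 + 1) * ‖f y' - p‖ ^ 2 := by
    intro y' hy'
    obtain ⟨hξ', -⟩ := hpar y' hy'
    refine sheet_frame_inner_sq_sum_le L D0 (fderiv ℝ u (A (f y' - p))) (hν1 y')
      (hνtan y' hy') (hνn y') ?_ ?_
    · calc ‖D0 - fderiv ℝ u (A (f y' - p))‖ ≤ κ * ‖(0 : E4) - A (f y' - p)‖ :=
            hD2 0 (mem_ball_self hρ) _ hξ'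
        _ ≤ κ * ‖f y' - p‖ := by
            rw [zero_sub, norm_neg]; exact mul_le_mul_of_nonneg_left (hAnorm y') hκ
    · calc ‖n p - n (f y')‖ ≤ ‖p - f y'‖ := hnlip p (f y')
        _ = ‖f y' - p‖ := norm_sub_rev _ _
  -- the connected piece `V ∋ x, y`
  set V : Set M := f ⁻¹' (Φ '' ball (0 : E4) ρ') with hV
  have hVconn : IsPreconnected V := by
    have hc : ContinuousOn Φ (ball (0 : E4) ρ') := by
      intro ξ hξ
      have h1 : HasFDerivAt (fun ξ' : E4 => p + L ξ') L.toContinuousLinearMap ξ :=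
        (L.toContinuousLinearMap.hasFDerivAt).const_add p
      exact (h1.add (hdiff ξ (hball hξ)).hasFDerivAt).continuousAt.continuousWithinAt
    exact ((convex_ball (0 : E4) ρ').isPreconnected.image Φ hc).preimage_of_isClosedMap hfinj
      hf.continuous.isClosedMap hΦrange
  have hxV : x ∈ V := ⟨0, mem_ball_self hρ'pos, by simp [hΦ, h0, hp]⟩
  have hVmem : ∀ y' ∈ V, f y' ∈ ball p ρ ∧ ‖f y' - p‖ < 2 * ρ' := by
    rintro y' ⟨ξ, hξ, hξy⟩
    have hξ' : ‖ξ‖ < ρ' := by simpa using hξ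
    refine ⟨hξy ▸ hΦball ξ hξ, ?_⟩
    rw [← hξy]
    calc ‖Φ ξ - p‖ ≤ 2 * ‖ξ‖ := hΦp ξ (hball hξ)
      _ < 2 * ρ' := by linarith
  have hyρ : f y ∈ ball p ρ := by
    rw [mem_ball, dist_eq_norm, norm_sub_rev]
    calc ‖p - f y‖ = ‖f x - f y‖ := by rw [hp]
      _ < ρ := by linarith
  have hyV : y ∈ V := by
    obtain ⟨-, hfy⟩ := hpar y hyρ
    refine ⟨A (f y - p), ?_, hfy.symm⟩
    rw [mem_ball, dist_zero_right]
    calc ‖A (f y - p)‖ ≤ ‖f y - p‖ := hAnorm y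
      _ = ‖f x - f y‖ := by rw [hp, norm_sub_rev]
      _ < ρ' := lt_of_lt_of_le hy le_rfl
  -- `⟪ν x, ν ·⟫` does not vanish on `V`
  have hane : ∀ y' ∈ V, ⟪ν x, ν y'⟫_ℝ ≠ 0 := by
    intro y' hy'
    obtain ⟨hy'ρ, hy'2⟩ := hVmem y' hy'
    refine inner_ne_zero_of_frame hfr (hν1 x) (hν1 y') hνxfr ?_
    have hnn : 0 ≤ ‖f y' - p‖ := norm_nonneg _
    have h1 := hδ y' hy'ρ
    have h2 : ‖f y' - p‖ ^ 2 ≤ (2 * ρ') ^ 2 := pow_le_pow_left₀ hnn hy'2.le 2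
    have hκ2 : 4 * κ ^ 2 + 1 < 4 * (κ + 1) ^ 2 := by
      have : 4 * (κ + 1) ^ 2 = 4 * κ ^ 2 + 1 + (8 * κ + 3) := by ring
      linarith only [this, hκ]
    have hκ2' : 4 * ρ' ^ 2 * (4 * κ ^ 2 + 1) < 4 * ρ' ^ 2 * (4 * (κ + 1) ^ 2) :=
      mul_lt_mul_of_pos_left hκ2 (by positivity)
    have hsq1 : (4 * (ρ' * (κ + 1))) ^ 2 ≤ 1 :=
      pow_le_one₀ (by positivity) (by linarith only [hρ'κ'])
    have h3 : (4 * κ ^ 2 + 1) * (2 * ρ') ^ 2 < 1 := by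
      calc (4 * κ ^ 2 + 1) * (2 * ρ') ^ 2 = 4 * ρ' ^ 2 * (4 * κ ^ 2 + 1) := by ring
        _ < 4 * ρ' ^ 2 * (4 * (κ + 1) ^ 2) := hκ2'
        _ = (4 * (ρ' * (κ + 1))) ^ 2 := by ring
        _ ≤ 1 := hsq1
    have h4 : (4 * κ ^ 2 + 1) * ‖f y' - p‖ ^ 2 ≤ (4 * κ ^ 2 + 1) * (2 * ρ') ^ 2 :=
      mul_le_mul_of_nonneg_left h2 (by positivity)
    exact lt_of_le_of_lt (h1.trans h4) h3
  -- hence the sign at `y` is `+`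
  have hapos : 0 ≤ ⟪ν x, ν y⟫_ℝ := by
    by_contra hneg
    rw [not_le] at hneg
    have hcont : ContinuousOn (fun y' => ⟪ν x, ν y'⟫_ℝ) V :=
      (continuous_const.inner hνc).continuousOn
    have hax : ⟪ν x, ν x⟫_ℝ = 1 := by rw [real_inner_self_eq_norm_sq, hν1]; norm_num
    have h := hVconn.intermediate_value hyV hxV hcont
    have h0mem : (0 : ℝ) ∈ Icc ⟪ν x, ν y⟫_ℝ ⟪ν x, ν x⟫_ℝ := ⟨hneg.le, by rw [hax]; norm_num⟩
    obtain ⟨z, hzV, hz⟩ := h h0mem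
    exact hane z hzV hz
  -- conclusion
  have hfin := norm_sub_sq_le_of_frame hfr (hν1 x) (hν1 y) hνxfr hapos
  have hsq : ‖ν x - ν y‖ ^ 2 ≤ (3 * (κ + 1) * ‖p - f y‖) ^ 2 := by
    rw [norm_sub_rev (ν x)]
    have hδy := hδ y hyρ
    rw [norm_sub_rev (f y) p] at hδy
    have hκ3 : 2 * (4 * κ ^ 2 + 1) ≤ (3 * (κ + 1)) ^ 2 := by
      have : (3 * (κ + 1)) ^ 2 = 2 * (4 * κ ^ 2 + 1) + (κ ^ 2 + 18 * κ + 7) := by ring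
      nlinarith only [this, hκ]
    calc ‖ν y - ν x‖ ^ 2 ≤ 2 * ∑ i, ⟪ν y, fr i⟫_ℝ ^ 2 := hfin
      _ ≤ 2 * ((4 * κ ^ 2 + 1) * ‖p - f y‖ ^ 2) := by gcongr
      _ = 2 * (4 * κ ^ 2 + 1) * ‖p - f y‖ ^ 2 := by ring
      _ ≤ (3 * (κ + 1)) ^ 2 * ‖p - f y‖ ^ 2 := by gcongr
      _ = (3 * (κ + 1) * ‖p - f y‖) ^ 2 := by ring
  exact (pow_le_pow_iff_left₀ (norm_nonneg _) (by positivity) two_ne_zero).1 hsq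


/-! ## The radial field of `S⁴ × ℝ ⊂ ℝ⁶` and the reduction of the named fact -/

/-- The radial field `z ↦ (z₀, …, z₄, 0)` of `ℝ⁶` (the unit normal of `S⁴ × ℝ` along it) pairs
with `w` to `∑_{i<5} zᵢ wᵢ`. [folklore] -/
theorem inner_radial_left (z w : E6) :
    ⟪z - z (Fin.last 5) • EuclideanSpace.single (Fin.last 5) (1 : ℝ), w⟫_ℝ =
      ∑ i : Fin 5, z (Fin.castSucc i) * w (Fin.castSucc i) := by
  rw [inner_sub_left, inner_smul_left, EuclideanSpace.inner_single_left]
  simp only [PiLp.inner_apply, RCLike.inner_apply, conj_trivial, Fin.sum_univ_castSucc, map_one,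
    one_mul]
  ring

/-- `‖(v₀, …, v₄, 0)‖² = ∑_{i<5} vᵢ²`. [folklore] -/
theorem norm_radial_sq (v : E6) :
    ‖v - v (Fin.last 5) • EuclideanSpace.single (Fin.last 5) (1 : ℝ)‖ ^ 2 =
      ∑ i : Fin 5, v (Fin.castSucc i) ^ 2 := by
  rw [← real_inner_self_eq_norm_sq, inner_radial_left]
  refine Finset.sum_congr rfl fun i _ => ?_
  have hne : (Fin.castSucc i : Fin 6) ≠ Fin.last 5 := (Fin.castSucc_lt_last i).ne
  rw [PiLp.sub_apply, PiLp.smul_apply, PiLp.single_apply, if_neg hne, smul_zero, sub_zero, sq]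

/-- `∑_{i<5} vᵢ² ≤ ‖v‖²` in `ℝ⁶`. [folklore] -/
theorem sum_sq_castSucc_le_norm_sq (v : E6) : ∑ i : Fin 5, v (Fin.castSucc i) ^ 2 ≤ ‖v‖ ^ 2 := by
  rw [EuclideanSpace.norm_sq_eq]
  conv_rhs => rw [Fin.sum_univ_castSucc]
  simp only [Real.norm_eq_abs, sq_abs]
  linarith [sq_nonneg (v (Fin.last 5))]

/-- The radial field is `1`-Lipschitz. [folklore] -/
theorem norm_radial_sub_radial_le (z z' : E6) :
    ‖(z - z (Fin.last 5) • EuclideanSpace.single (Fin.last 5) (1 : ℝ)) -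
      (z' - z' (Fin.last 5) • EuclideanSpace.single (Fin.last 5) (1 : ℝ))‖ ≤ ‖z - z'‖ := by
  have h : (z - z (Fin.last 5) • EuclideanSpace.single (Fin.last 5) (1 : ℝ)) -
      (z' - z' (Fin.last 5) • EuclideanSpace.single (Fin.last 5) (1 : ℝ)) =
      (z - z') - (z - z') (Fin.last 5) • EuclideanSpace.single (Fin.last 5) (1 : ℝ) := by
    rw [PiLp.sub_apply, sub_smul]; abel
  rw [h]
  have h2 := (norm_radial_sq (z - z')).trans_le (sum_sq_castSucc_le_norm_sq (z - z'))
  exact (pow_le_pow_iff_left₀ (norm_nonneg _) (norm_nonneg _) two_ne_zero).1 h2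

/-- **Tangency to the cylinder**: if `f : M → ℝ⁶` is `C¹` with image in `N = {∑_{i<5} zᵢ² = 1}`,
then the radial field at `f y` is orthogonal to `df_y v` (differentiate `∑_{i<5} (f ·)ᵢ² ≡ 1` along
`M`). [folklore] -/
theorem inner_radial_mfderiv_eq_zero_of_mem_cylinder {M : Type*} [TopologicalSpace M]
    [ChartedSpace E4 M] {f : M → E6} (hf : ContMDiff (𝓡 4) (𝓡 6) 1 f)
    (hN : ∀ y, ∑ i : Fin 5, f y (Fin.castSucc i) ^ 2 = 1) (y : M) (v : E4) :
    ⟪f y - f y (Fin.last 5) • EuclideanSpace.single (Fin.last 5) (1 : ℝ),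
      mfderiv (𝓡 4) (𝓡 6) f y v⟫_ℝ = 0 := by
  set Df : E4 →L[ℝ] E6 := mfderiv (𝓡 4) (𝓡 6) f y with hDf
  change ⟪f y - f y (Fin.last 5) • EuclideanSpace.single (Fin.last 5) (1 : ℝ), Df v⟫_ℝ = 0
  rw [inner_radial_left]
  -- the function `G z = ∑_{i<5} zᵢ²` and its derivative
  set G : E6 → ℝ := fun z => ∑ i : Fin 5, (EuclideanSpace.proj (Fin.castSucc i) z : ℝ) ^ 2 with hG
  set G' : E6 →L[ℝ] ℝ := ∑ i : Fin 5,
    ((2 : ℝ) * (EuclideanSpace.proj (𝕜 := ℝ) (Fin.castSucc i) (f y)) ^ (2 - 1)) •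
      EuclideanSpace.proj (𝕜 := ℝ) (Fin.castSucc i) with hG'
  have hGd : HasFDerivAt G G' (f y) := by
    simp only [hG, hG']
    refine HasFDerivAt.fun_sum fun i _ => ?_
    simpa using ((EuclideanSpace.proj (𝕜 := ℝ) (Fin.castSucc i)).hasFDerivAt (x := f y)).pow 2
  -- chain rule along `M`; `G ∘ f ≡ 1`
  have hfd : HasMFDerivAt (𝓡 4) (𝓡 6) f y Df := (hf.mdifferentiableAt one_ne_zero).hasMFDerivAt
  have hchain : HasMFDerivAt (𝓡 4) 𝓘(ℝ, ℝ) (G ∘ f) y (G'.comp Df) := hGd.hasMFDerivAt.comp y hfd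
  have hconst : G ∘ f = fun _ => (1 : ℝ) := by
    funext y'
    simp only [Function.comp_apply, hG, EuclideanSpace.coe_proj]
    exact hN y'
  rw [hconst] at hchain
  have h0 : G'.comp Df = 0 := by
    have h := hchain.mfderiv
    rw [mfderiv_const] at h
    exact h.symm
  have h := congrArg (fun T : E4 →L[ℝ] ℝ => T v) h0
  simp only [ContinuousLinearMap.coe_comp, Function.comp_apply, hG', EuclideanSpace.coe_proj] at h
  simp only [_root_.sum_apply, _root_.smul_apply, PiLp.proj_apply, smul_eq_mul, zero_apply] at h
  have h' : ∑ i : Fin 5, f y (Fin.castSucc i) * (Df v) (Fin.castSucc i) =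
      (1 / 2) * ∑ i : Fin 5, 2 * f y (Fin.castSucc i) ^ (2 - 1) * (Df v) (Fin.castSucc i) := by
    rw [Finset.mul_sum]
    refine Finset.sum_congr rfl fun i _ => ?_
    ring
  rw [h', h, mul_zero]


/-! ## The named fact from White's conclusion in sheet form -/

section Reduction

open Literature.Geometry.Lorentzian Literature.Geometry.Lorentzian.PseudoRiemannianMetric

/-- **`White2005_localRegularity_cylinderFlowSheet` follows from White's `K_{2,α}` estimate in sheet
form.**  The hypothesis `hcore` is White 2005, Thm. 4.1 (with Thm. 3.2 for the threshold `ε̄` and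
the Brakke operator of mean curvature flow in `N = S⁴ × ℝ ⊂ ℝ⁶`, §4 problem (3)) at the top-time
points `X = (F t x, t)` of `U = ℝ⁶ × (t - d², t + d²)`, `K_{2,α}(𝓜; X) · d ≤ C_W`, read through the
definition of `K_{2,α}` (§2.5 and the Remark on p. 1494) on the time-`t` slice and keeping only the
`C^{1,1}` information: a sheet of `M_t = range (F t)` at every `F t x` of radius `d/C` whose `Du` is
`(C/d)`-Lipschitz (`C = 2 C_W`; a good dilation factor `λ ∈ [K_{2,α}, 2K_{2,α}]` exists since
`K_{2,α}` is an infimum).  From it the fact's conclusions follow by `sheet_normal_estimate` (a′)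
with the radial field `n z = (z₀,…,z₄,0)` (unit and normal to `M_t ⊂ N` along `M_t`,
`inner_radial_mfderiv_eq_zero_of_mem_cylinder`; `ν t ⊥ n` is a hypothesis of the fact) and by
`le_hausdorffMeasure_inter_ball_of_sheet` (b′), with constants `ε`, `C′ = 3(C+1)`, `c = 1/16`,
`c₁ = 1/(8(C+1))`, `d₀′ = min d₀ 1`.  What is NOT proved here is `hcore` itself (White's Theorem
4.1: parabolic Schauder estimates, Arzelà–Ascoli for `C^{2,α}` flows, monotonicity rigidity).
[cite: White2005, Thm. 4.1 and §2.5] -/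
theorem White2005_localRegularity_cylinderFlowSheet_of_sheets
    (hcore : ∃ ε : ℝ, 0 < ε ∧ ∃ C : ℝ, 0 < C ∧ ∃ d₀ : ℝ, 0 < d₀ ∧
      ∀ (M : Type) [TopologicalSpace M] [T2Space M] [SecondCountableTopology M]
        [ChartedSpace E4 M] [IsManifold (𝓡 4) ∞ M] [CompactSpace M]
        [ConnectedSpace M]
        (F : ℝ → M → EuclideanSpace ℝ (Fin 6)) (ν : ℝ → M → EuclideanSpace ℝ (Fin 6)) (T : ℝ),
        (∃ U : Set ℝ, IsOpen U ∧ Set.Ici T ⊆ U ∧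
          ContMDiffOn (𝓘(ℝ, ℝ).prod (𝓡 4)) (𝓡 6) ∞ (fun p : ℝ × M => F p.1 p.2) (U ×ˢ Set.univ)) →
        (∀ t, T ≤ t → Manifold.IsSmoothEmbedding (𝓡 4) (𝓡 6) ∞ (F t)) →
        (∀ t, T ≤ t → ∀ x, ∑ i : Fin 5, F t x (Fin.castSucc i) ^ 2 = 1) →
        ∀ himm : ∀ t, T ≤ t →
          (euclideanMetric E6).IsSpacelikeImmersion (𝓡 4) (F t),
        (∀ t, T ≤ t →
          (euclideanMetric E6).IsUnitNormal (𝓡 4) (F t) (ν t) 1) →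
        (∀ t, T ≤ t → ∀ x, ∑ i : Fin 5, ν t x (Fin.castSucc i) * F t x (Fin.castSucc i) = 0) →
        (∀ t, T ≤ t → ContMDiff (𝓡 4) (𝓡 6) ∞ (ν t)) →
        (∀ t (ht : T ≤ t) (x : M), mfderiv 𝓘(ℝ, ℝ) (𝓡 6) (fun s => F s x) t (1 : ℝ) =
          -((euclideanMetric E6).meanCurvature (F t)
              contMDiff_pullbackBilin_holds (himm t ht) (ν t) x) • ν t x) →
        ∀ t d : ℝ, 0 < d → d ≤ d₀ → T + d ^ 2 ≤ t →
        (∀ (y : EuclideanSpace ℝ (Fin 6)) (s r : ℝ), 0 < r → t - d ^ 2 ≤ s - r ^ 2 →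
          s ≤ t + d ^ 2 →
          gaussianArea 4 y (r ^ 2) (Set.range (F (s - r ^ 2))) ≤ ENNReal.ofReal (1 + ε)) →
        ∀ x : M, ∃ (L : E4 →ₗᵢ[ℝ] E6) (u : E4 → E6), u 0 = 0 ∧
          (∀ ξ ∈ ball (0 : E4) (d / C), ∀ η, ⟪u ξ, L η⟫_ℝ = 0) ∧
          (∀ ξ ∈ ball (0 : E4) (d / C), DifferentiableAt ℝ u ξ) ∧
          (∀ ξ ∈ ball (0 : E4) (d / C), ‖fderiv ℝ u ξ‖ ≤ 1) ∧
          (∀ ξ ∈ ball (0 : E4) (d / C), ∀ ξ' ∈ ball (0 : E4) (d / C),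
            ‖fderiv ℝ u ξ - fderiv ℝ u ξ'‖ ≤ C / d * ‖ξ - ξ'‖) ∧
          Set.range (F t) ∩ ball (F t x) (d / C) =
            (fun ξ => F t x + L ξ + u ξ) '' ball (0 : E4) (d / C) ∩ ball (F t x) (d / C)) :
    White2005_localRegularity_cylinderFlowSheet := by
  obtain ⟨ε, hε, C, hC, d₀, hd₀, hcore⟩ := hcore
  refine ⟨ε, hε, 3 * (C + 1), by positivity, 1 / 16, by norm_num, 1 / (8 * (C + 1)), by positivity,
    min d₀ 1, by positivity, ?_⟩
  intro M _ _ _ _ _ _ _ F ν T hsmooth hemb hN himm hun hνN hνs hmcf t d hd hdd₀ hTt hdens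
  have hd1 : d ≤ 1 := hdd₀.trans (min_le_right _ _)
  have hdd : d ≤ d₀ := hdd₀.trans (min_le_left _ _)
  have hsheet := hcore M F ν T hsmooth hemb hN himm hun hνN hνs hmcf t d hd hdd hTt hdens
  have ht : T ≤ t := by nlinarith only [hTt, sq_nonneg d]
  -- the time-`t` slice
  have hf1 : ContMDiff (𝓡 4) (𝓡 6) 1 (F t) := (himm t ht).contMDiff.of_le le_add_self
  have hfinj : Function.Injective (F t) := (hemb t ht).isEmbedding.injective
  have hinj : ∀ y, Function.Injective (mfderiv (𝓡 4) (𝓡 6) (F t) y) :=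
    (himm t ht).injective_mfderiv
  have hνc : Continuous (ν t) := (hνs t ht).continuous
  have hν1 : ∀ y, ‖ν t y‖ = 1 := by
    intro y
    have h : ⟪ν t y, ν t y⟫_ℝ = 1 := by
      have h' := (hun t ht).2 y
      rwa [euclideanMetric_apply] at h'
    rw [real_inner_self_eq_norm_sq] at h
    exact (pow_eq_one_iff_of_nonneg (norm_nonneg _) two_ne_zero).1 h
  have hνt : ∀ y (v : E4), ⟪ν t y, mfderiv (𝓡 4) (𝓡 6) (F t) y v⟫_ℝ = 0 := by
    intro y v
    have h := (hun t ht).1 y v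
    rwa [euclideanMetric_apply] at h
  -- the radial field `n z = (z₀, …, z₄, 0)`
  have hn1 : ∀ y,
      ‖F t y - F t y (Fin.last 5) • EuclideanSpace.single (Fin.last 5) (1 : ℝ)‖ = 1 := by
    intro y
    have h := norm_radial_sq (F t y)
    rw [hN t ht y] at h
    exact (pow_eq_one_iff_of_nonneg (norm_nonneg _) two_ne_zero).1 h
  have hνn : ∀ y, ⟪ν t y, F t y - F t y (Fin.last 5) • EuclideanSpace.single (Fin.last 5) (1 : ℝ)⟫_ℝ
      = 0 := by
    intro y
    rw [real_inner_comm, inner_radial_left]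
    simpa [mul_comm] using hνN t ht y
  have hnt : ∀ y (v : E4), ⟪F t y - F t y (Fin.last 5) • EuclideanSpace.single (Fin.last 5) (1 : ℝ),
      mfderiv (𝓡 4) (𝓡 6) (F t) y v⟫_ℝ = 0 :=
    inner_radial_mfderiv_eq_zero_of_mem_cylinder hf1 (hN t ht)
  have hκ : 0 ≤ C / d := by positivity
  have hρ : 0 < d / C := by positivity
  -- `c₁ d` is below both radii
  have hc₁ρ : 1 / (8 * (C + 1)) * d ≤ d / C := by
    rw [one_div_mul_eq_div]
    exact div_le_div_of_nonneg_left hd.le hC (by linarith)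
  have hc₁lt : 1 / (8 * (C + 1)) * d < min (d / C / 2) (1 / (4 * (C / d + 1))) := by
    rw [one_div_mul_eq_div]
    refine lt_min ?_ ?_
    · rw [div_div, div_lt_div_iff_of_pos_left hd (by positivity) (by positivity)]
      linarith
    · have h1 : 1 / (4 * (C / d + 1)) = d / (4 * (C + d)) := by
        field_simp
      rw [h1, div_lt_div_iff_of_pos_left hd (by positivity) (by positivity)]
      linarith
  constructor
  · -- (a′)
    intro x y hxy
    obtain ⟨L, u, h0, horth, hdiff, hD, hD2, hS⟩ := hsheet x
    have key := sheet_normal_estimate hf1 hfinj hinj hνc hν1 hνt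
      (n := fun z : E6 => z - z (Fin.last 5) • EuclideanSpace.single (Fin.last 5) (1 : ℝ))
      (fun z z' => norm_radial_sub_radial_le z z') hn1 hνn hnt hκ L h0 horth hdiff hD hD2 hS
      (y := y) (lt_of_le_of_lt hxy hc₁lt)
    calc ‖ν t x - ν t y‖ ≤ 3 * (C / d + 1) * ‖F t x - F t y‖ := key
      _ ≤ 3 * (C + 1) / d * ‖F t x - F t y‖ := by
          gcongr
          rw [le_div_iff₀ hd]
          nlinarith only [hd, hd1, hC, div_mul_cancel₀ C hd.ne']
  · -- (b′)
    intro x r hr hrd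
    obtain ⟨L, u, h0, horth, hdiff, hD, -, hS⟩ := hsheet x
    have h := le_hausdorffMeasure_inter_ball_of_sheet L h0 horth hdiff hD hS hr (hrd.trans hc₁ρ)
    have hr4 : 1 / 16 * r ^ 4 = (r / 2) ^ 4 := by ring
    rwa [hr4]

end Reduction

/-! ## Sheets from containment (White's Remark, §2.5 p. 1494)

White's definition of `K_{2,α} ≤ 1` only asks that `𝓜 ∩ B^{N,1}` be CONTAINED in a graph;
equality (`𝓜′ ∩ B^{N,1} = graph(u) ∩ B^{N,1}`) is his Remark for fully regular proper flows.  For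
the compact embedded slices of the named fact we PROVE the equality from containment: the
parameter region `Ω = {ξ ∈ B(0, ρ) : Φ ξ ∈ B(p, ρ)}` is star-shaped (from `‖Du‖ ≤ 1`, `u 0 = 0`),
hence connected, and its subset of parameters realised by `f` is open (inverse function theorem
for `L†(· - p) ∘ f` in charts) and closed (`range f` is compact), and contains `0`. -/

section Containment

variable {M : Type*} [TopologicalSpace M] [ChartedSpace (EuclideanSpace ℝ (Fin 4)) M]

/-- Points of `S` in the sheet ball are sheet points (containment form of
`exists_param_of_mem_sheet`). [folklore] -/
theorem exists_param_of_subset_sheet {S : Set E6} {p : E6} {ρ : ℝ} (L : E4 →ₗᵢ[ℝ] E6) {u : E4 → E6}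
    (horth : ∀ ξ ∈ ball (0 : E4) ρ, ∀ η, ⟪u ξ, L η⟫_ℝ = 0)
    (hS : S ∩ ball p ρ ⊆ (fun ξ => p + L ξ + u ξ) '' ball (0 : E4) ρ)
    {z : E6} (hzS : z ∈ S) (hz : z ∈ ball p ρ) :
    ContinuousLinearMap.adjoint L.toContinuousLinearMap (z - p) ∈ ball (0 : E4) ρ ∧
      z = p + L (ContinuousLinearMap.adjoint L.toContinuousLinearMap (z - p)) +
        u (ContinuousLinearMap.adjoint L.toContinuousLinearMap (z - p)) := by
  obtain ⟨ξ, hξ, rfl⟩ := hS ⟨hzS, hz⟩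
  rw [adjoint_apply_sheet L (horth ξ hξ)]
  exact ⟨hξ, rfl⟩

/-- Containment form of `sheet_tangent_mem_range_mfderiv`: the range of `df_y` contains the
tangent plane of the graph at the parameter of `f y`, and (a by-product of the chain rule) the
chart map `L†(· - p) ∘ f` has injective differential at `y`. [cite: White2005, §2.5] -/
theorem sheet_tangent_of_subset {f : M → E6} (hf : ContMDiff (𝓡 4) (𝓡 6) 1 f)
    (hinj : ∀ y, Function.Injective (mfderiv (𝓡 4) (𝓡 6) f y))
    {p : E6} {ρ : ℝ} (L : E4 →ₗᵢ[ℝ] E6) {u : E4 → E6}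
    (horth : ∀ ξ ∈ ball (0 : E4) ρ, ∀ η, ⟪u ξ, L η⟫_ℝ = 0)
    (hdiff : ∀ ξ ∈ ball (0 : E4) ρ, DifferentiableAt ℝ u ξ)
    (hS : Set.range f ∩ ball p ρ ⊆ (fun ξ => p + L ξ + u ξ) '' ball (0 : E4) ρ)
    {y : M} (hy : f y ∈ ball p ρ) :
    (∀ η : E4, ∃ w : E4, mfderiv (𝓡 4) (𝓡 6) f y w =
      (L η + fderiv ℝ u (ContinuousLinearMap.adjoint L.toContinuousLinearMap (f y - p)) η : E6)) ∧
    Function.Injective (fun w : E4 => ContinuousLinearMap.adjoint L.toContinuousLinearMap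
      ((mfderiv (𝓡 4) (𝓡 6) f y : E4 →L[ℝ] E6) w)) := by
  set A : E6 →L[ℝ] E4 := ContinuousLinearMap.adjoint L.toContinuousLinearMap with hA
  set Φ : E4 → E6 := fun ξ => p + L ξ + u ξ with hΦ
  set ξ : E4 := A (f y - p) with hξdef
  obtain ⟨hξ, hfy⟩ := exists_param_of_subset_sheet L horth hS (mem_range_self y) hy
  have hev : f =ᶠ[𝓝 y] (fun z : E6 => Φ (A (z - p))) ∘ f := by
    have hV : f ⁻¹' ball p ρ ∈ 𝓝 y := (hf.continuous.isOpen_preimage _ isOpen_ball).mem_nhds hy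
    filter_upwards [hV] with y' hy'
    exact (exists_param_of_subset_sheet L horth hS (mem_range_self y') hy').2
  have hΦd : HasFDerivAt Φ (L.toContinuousLinearMap + fderiv ℝ u ξ) ξ := by
    have h1 : HasFDerivAt (fun ξ' : E4 => p + L ξ') L.toContinuousLinearMap ξ :=
      (L.toContinuousLinearMap.hasFDerivAt).const_add p
    exact h1.add (hdiff ξ hξ).hasFDerivAt
  have hψd : HasFDerivAt (fun z : E6 => A (z - p)) A (f y) := by
    have h := (A.hasFDerivAt (x := f y - p)).comp (f y) ((hasFDerivAt_id (f y)).sub_const p)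
    simpa [Function.comp_def] using h
  have hcomp : HasFDerivAt (fun z : E6 => Φ (A (z - p)))
      ((L.toContinuousLinearMap + fderiv ℝ u ξ).comp A) (f y) := by
    have := hΦd
    rw [hξdef] at this
    exact this.comp (f y) hψd
  set Df : E4 →L[ℝ] E6 := mfderiv (𝓡 4) (𝓡 6) f y with hDf
  have hfd : HasMFDerivAt (𝓡 4) (𝓡 6) f y Df := (hf.mdifferentiableAt one_ne_zero).hasMFDerivAt
  have hchain : HasMFDerivAt (𝓡 4) (𝓡 6) ((fun z : E6 => Φ (A (z - p))) ∘ f) y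
      (((L.toContinuousLinearMap + fderiv ℝ u ξ).comp A).comp Df) :=
    hcomp.hasMFDerivAt.comp y hfd
  set T : E4 →L[ℝ] E6 := L.toContinuousLinearMap + fderiv ℝ u ξ with hT
  have heq : Df = (T.comp A).comp Df := (hchain.congr_of_eventuallyEq hev).mfderiv
  have hinj' : Function.Injective (Df : E4 →ₗ[ℝ] E6) := hinj y
  refine ⟨fun η => ?_, ?_⟩
  · set R₁ : Submodule ℝ E6 := LinearMap.range (Df : E4 →ₗ[ℝ] E6) with hR₁
    set R₂ : Submodule ℝ E6 := LinearMap.range (T : E4 →ₗ[ℝ] E6) with hR₂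
    have hle : R₁ ≤ R₂ := by
      rintro v ⟨w, rfl⟩
      refine ⟨A (Df w), ?_⟩
      change T (A (Df w)) = Df w
      conv_rhs => rw [heq]
      rfl
    have h1 : finrank ℝ R₁ = 4 := by
      have := LinearMap.finrank_range_of_inj hinj'
      simpa using this
    have h2 : finrank ℝ R₂ ≤ 4 := by
      simpa using LinearMap.finrank_range_le (T : E4 →ₗ[ℝ] E6)
    have hR : R₁ = R₂ := Submodule.eq_of_le_of_finrank_le hle (by omega)
    have hmem : (T η : E6) ∈ R₁ := by rw [hR]; exact ⟨η, rfl⟩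
    obtain ⟨w, hw⟩ := hmem
    refine ⟨w, ?_⟩
    change (Df w : E6) = _
    have hw' : Df w = T η := hw
    rw [hw', hT]
    rfl
  · intro w₁ w₂ h12
    apply hinj'
    change Df w₁ = Df w₂
    have h1 : Df w₁ = ((T.comp A).comp Df) w₁ := congrArg (fun F : E4 →L[ℝ] E6 => F w₁) heq
    have h2 : Df w₂ = ((T.comp A).comp Df) w₂ := congrArg (fun F : E4 →L[ℝ] E6 => F w₂) heq
    rw [h1, h2]
    change T (A (Df w₁)) = T (A (Df w₂))
    exact congrArg T h12

/-- Pythagoras on a sheet: `‖Φ ξ - p‖² = ‖ξ‖² + ‖u ξ‖²`. [folklore] -/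
theorem norm_sheet_sub_sq {p : E6} (L : E4 →ₗᵢ[ℝ] E6) {u : E4 → E6} {ξ : E4}
    (hξ : ∀ η, ⟪u ξ, L η⟫_ℝ = 0) : ‖p + L ξ + u ξ - p‖ ^ 2 = ‖ξ‖ ^ 2 + ‖u ξ‖ ^ 2 := by
  have h : p + L ξ + u ξ - p = L ξ + u ξ := by abel
  rw [h, norm_add_sq_real, L.norm_map, real_inner_comm, hξ ξ]
  ring

/-- **The parameter region of a sheet is star-shaped**: if `ξ ∈ B(0, ρ)` with `Φ ξ ∈ B(p, ρ)` then
`Φ (b ξ) ∈ B(p, ρ)` for `0 ≤ b ≤ 1` (uses only `u 0 = 0`, `‖Du‖ ≤ 1`, `u ⊥ range L`: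
`‖u(bξ)‖² - ‖u ξ‖² ≤ ‖u(bξ) - u ξ‖ (‖u(bξ)‖ + ‖u ξ‖) ≤ (1-b)(1+b)‖ξ‖²`). [folklore] -/
theorem sheet_smul_mem_ball {p : E6} {ρ : ℝ} (L : E4 →ₗᵢ[ℝ] E6) {u : E4 → E6} (h0 : u 0 = 0)
    (horth : ∀ ξ ∈ ball (0 : E4) ρ, ∀ η, ⟪u ξ, L η⟫_ℝ = 0)
    (hdiff : ∀ ξ ∈ ball (0 : E4) ρ, DifferentiableAt ℝ u ξ)
    (hD : ∀ ξ ∈ ball (0 : E4) ρ, ‖fderiv ℝ u ξ‖ ≤ 1)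
    {ξ : E4} (hξ : ξ ∈ ball (0 : E4) ρ) (hΦξ : p + L ξ + u ξ ∈ ball p ρ)
    {b : ℝ} (hb0 : 0 ≤ b) (hb1 : b ≤ 1) : p + L (b • ξ) + u (b • ξ) ∈ ball p ρ := by
  have hbξ : b • ξ ∈ ball (0 : E4) ρ := by
    rw [mem_ball, dist_zero_right, norm_smul, Real.norm_eq_abs, abs_of_nonneg hb0]
    have : ‖ξ‖ < ρ := by simpa using hξ
    nlinarith [norm_nonneg ξ]
  rw [mem_ball, dist_eq_norm] at hΦξ ⊢
  have hρ : 0 < ρ := (norm_nonneg _).trans_lt hΦξ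
  -- squared distances
  have hsq1 : ‖p + L ξ + u ξ - p‖ ^ 2 = ‖ξ‖ ^ 2 + ‖u ξ‖ ^ 2 := norm_sheet_sub_sq L (horth ξ hξ)
  have hsqb : ‖p + L (b • ξ) + u (b • ξ) - p‖ ^ 2 = ‖b • ξ‖ ^ 2 + ‖u (b • ξ)‖ ^ 2 :=
    norm_sheet_sub_sq L (horth _ hbξ)
  -- mean value bounds
  have hu1 : ‖u ξ‖ ≤ ‖ξ‖ := norm_le_of_fderiv_le_one h0 hdiff hD hξ
  have hub : ‖u (b • ξ)‖ ≤ b * ‖ξ‖ := by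
    have h := norm_le_of_fderiv_le_one h0 hdiff hD hbξ
    rwa [norm_smul, Real.norm_eq_abs, abs_of_nonneg hb0] at h
  have hdiffb : ‖u (b • ξ) - u ξ‖ ≤ (1 - b) * ‖ξ‖ := by
    have h := (convex_ball (0 : E4) ρ).norm_image_sub_le_of_norm_fderiv_le hdiff hD hξ hbξ
    rw [one_mul] at h
    calc ‖u (b • ξ) - u ξ‖ ≤ ‖b • ξ - ξ‖ := h
      _ = (1 - b) * ‖ξ‖ := by
          rw [show b • ξ - ξ = -((1 - b) • ξ) by rw [sub_smul, one_smul]; abel, norm_neg, norm_smul,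
            Real.norm_eq_abs, abs_of_nonneg (by linarith)]
  -- `‖u(bξ)‖² - ‖u ξ‖² ≤ (1 - b²) ‖ξ‖²`
  have hkey : ‖u (b • ξ)‖ ^ 2 - ‖u ξ‖ ^ 2 ≤ (1 - b ^ 2) * ‖ξ‖ ^ 2 := by
    have h1 : ‖u (b • ξ)‖ - ‖u ξ‖ ≤ (1 - b) * ‖ξ‖ := (norm_sub_norm_le _ _).trans hdiffb
    have h2 : ‖u (b • ξ)‖ + ‖u ξ‖ ≤ (1 + b) * ‖ξ‖ := by linarith
    have h3 : 0 ≤ ‖u (b • ξ)‖ + ‖u ξ‖ := by positivity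
    calc ‖u (b • ξ)‖ ^ 2 - ‖u ξ‖ ^ 2 = (‖u (b • ξ)‖ - ‖u ξ‖) * (‖u (b • ξ)‖ + ‖u ξ‖) := by ring
      _ ≤ (1 - b) * ‖ξ‖ * ((1 + b) * ‖ξ‖) := by
          by_cases hneg : ‖u (b • ξ)‖ - ‖u ξ‖ ≤ 0
          · calc (‖u (b • ξ)‖ - ‖u ξ‖) * (‖u (b • ξ)‖ + ‖u ξ‖) ≤ 0 :=
                  mul_nonpos_of_nonpos_of_nonneg hneg h3
              _ ≤ (1 - b) * ‖ξ‖ * ((1 + b) * ‖ξ‖) := by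
                  have : 0 ≤ 1 - b := by linarith
                  positivity
          · rw [not_le] at hneg
            exact mul_le_mul h1 h2 h3 (by positivity)
      _ = (1 - b ^ 2) * ‖ξ‖ ^ 2 := by ring
  have hfinal : ‖p + L (b • ξ) + u (b • ξ) - p‖ ^ 2 ≤ ‖p + L ξ + u ξ - p‖ ^ 2 := by
    rw [hsq1, hsqb, norm_smul, Real.norm_eq_abs, abs_of_nonneg hb0]
    nlinarith [hkey]
  exact lt_of_le_of_lt ((pow_le_pow_iff_left₀ (norm_nonneg _) (norm_nonneg _) two_ne_zero).1 hfinal)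
    hΦξ

/-- The parameter region `{ξ ∈ B(0, ρ) : Φ ξ ∈ B(p, ρ)}` of a sheet is preconnected (star-shaped
at `0`). [folklore] -/
theorem isPreconnected_sheetDomain {p : E6} {ρ : ℝ} (hρ : 0 < ρ) (L : E4 →ₗᵢ[ℝ] E6) {u : E4 → E6}
    (h0 : u 0 = 0) (horth : ∀ ξ ∈ ball (0 : E4) ρ, ∀ η, ⟪u ξ, L η⟫_ℝ = 0)
    (hdiff : ∀ ξ ∈ ball (0 : E4) ρ, DifferentiableAt ℝ u ξ)
    (hD : ∀ ξ ∈ ball (0 : E4) ρ, ‖fderiv ℝ u ξ‖ ≤ 1) :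
    IsPreconnected {ξ : E4 | ξ ∈ ball (0 : E4) ρ ∧ p + L ξ + u ξ ∈ ball p ρ} := by
  have hstar : StarConvex ℝ (0 : E4) {ξ : E4 | ξ ∈ ball (0 : E4) ρ ∧ p + L ξ + u ξ ∈ ball p ρ} := by
    intro ξ hξ a b ha hb hab
    rw [smul_zero, zero_add]
    have hb1 : b ≤ 1 := by linarith
    refine ⟨?_, sheet_smul_mem_ball L h0 horth hdiff hD hξ.1 hξ.2 hb hb1⟩
    rw [mem_ball, dist_zero_right, norm_smul, Real.norm_eq_abs, abs_of_nonneg hb]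
    have : ‖ξ‖ < ρ := by simpa using hξ.1
    nlinarith [norm_nonneg ξ]
  have h0mem : (0 : E4) ∈ {ξ : E4 | ξ ∈ ball (0 : E4) ρ ∧ p + L ξ + u ξ ∈ ball p ρ} :=
    ⟨mem_ball_self hρ, by simp [h0, hρ]⟩
  exact (hstar.isPathConnected h0mem).isConnected.isPreconnected

end Containment


section ContainmentEquality

variable {M : Type*} [TopologicalSpace M] [ChartedSpace (EuclideanSpace ℝ (Fin 4)) M]

/-- **Local surjectivity of a `C¹` map with injective differential between `4`-spaces** (inverse
function theorem in a chart): `g '' V` is a neighbourhood of `g y` for every neighbourhood `V` of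
`y`. [folklore] -/
theorem image_mem_nhds_of_injective_mfderiv {g : M → E4} (hg : ContMDiff (𝓡 4) 𝓘(ℝ, E4) 1 g)
    {y : M} (hinj : Function.Injective (mfderiv (𝓡 4) 𝓘(ℝ, E4) g y)) {V : Set M} (hV : V ∈ 𝓝 y) :
    g '' V ∈ 𝓝 (g y) := by
  set e := extChartAt (𝓡 4) y with he
  set G : E4 → E4 := g ∘ e.symm with hG
  -- `G` is `C¹` at `e y` with derivative `mfderiv g y`
  have hmd : MDifferentiableAt (𝓡 4) 𝓘(ℝ, E4) g y := hg.mdifferentiableAt one_ne_zero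
  have hGd : ContDiffAt ℝ 1 G (e y) := by
    have h := (contMDiffAt_iff.1 (hg y)).2
    simp only [extChartAt_model_space_eq_id, PartialEquiv.refl_coe, Function.id_comp,
      ModelWithCorners.range_eq_univ, contDiffWithinAt_univ] at h
    exact h
  set D : E4 →L[ℝ] E4 := mfderiv (𝓡 4) 𝓘(ℝ, E4) g y with hD
  have hDeq : fderiv ℝ G (e y) = D := by
    rw [hD, hmd.mfderiv]
    simp only [writtenInExtChartAt, extChartAt_model_space_eq_id, PartialEquiv.refl_coe,
      Function.id_comp, ModelWithCorners.range_eq_univ, fderivWithin_univ]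
    rfl
  have hstrict : HasStrictFDerivAt G D (e y) := hDeq ▸ hGd.hasStrictFDerivAt one_ne_zero
  -- injective endomorphism of `ℝ⁴` is surjective
  have hsurj : LinearMap.range (D : E4 →ₗ[ℝ] E4) = ⊤ :=
    LinearMap.range_eq_top.2 ((LinearMap.injective_iff_surjective).1 hinj)
  have hmap : Filter.map G (𝓝 (e y)) = 𝓝 (G (e y)) := hstrict.map_nhds_eq_of_surj hsurj
  have hGy : G (e y) = g y := by simp [hG, he]
  -- push the neighbourhood through the chart
  have hW : e.symm ⁻¹' V ∈ 𝓝 (e y) := by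
    refine (continuousAt_extChartAt_symm y).preimage_mem_nhds ?_
    rwa [extChartAt_to_inv]
  have himg : G '' (e.symm ⁻¹' V) ∈ 𝓝 (g y) := by
    rw [← hGy, ← hmap]; exact Filter.image_mem_map hW
  refine Filter.mem_of_superset himg ?_
  rintro _ ⟨ξ', hξ', rfl⟩
  exact ⟨e.symm ξ', hξ', rfl⟩

/-- **A sheet from containment** (White's Remark, §2.5 p. 1494, for compact embedded slices): if
`range f ∩ B(p, ρ)` is merely CONTAINED in the graph `Φ(B(0, ρ))` of a sheet at `p = f x`
(`u 0 = 0`, `u ⊥ range L`, `‖Du‖ ≤ 1`), `f` a `C¹` immersion of a compact `M`, then in fact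
`range f ∩ B(p, ρ) = Φ(B(0, ρ)) ∩ B(p, ρ)`. [cite: White2005, §2.5] -/
theorem sheet_eq_of_subset [CompactSpace M] {f : M → E6} (hf : ContMDiff (𝓡 4) (𝓡 6) 1 f)
    (hinj : ∀ y, Function.Injective (mfderiv (𝓡 4) (𝓡 6) f y))
    {x : M} {ρ : ℝ} (hρ : 0 < ρ) (L : E4 →ₗᵢ[ℝ] E6) {u : E4 → E6} (h0 : u 0 = 0)
    (horth : ∀ ξ ∈ ball (0 : E4) ρ, ∀ η, ⟪u ξ, L η⟫_ℝ = 0)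
    (hdiff : ∀ ξ ∈ ball (0 : E4) ρ, DifferentiableAt ℝ u ξ)
    (hD : ∀ ξ ∈ ball (0 : E4) ρ, ‖fderiv ℝ u ξ‖ ≤ 1)
    (hS : Set.range f ∩ ball (f x) ρ ⊆ (fun ξ => f x + L ξ + u ξ) '' ball (0 : E4) ρ) :
    Set.range f ∩ ball (f x) ρ =
      (fun ξ => f x + L ξ + u ξ) '' ball (0 : E4) ρ ∩ ball (f x) ρ := by
  set p : E6 := f x with hp
  set A : E6 →L[ℝ] E4 := ContinuousLinearMap.adjoint L.toContinuousLinearMap with hA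
  set Φ : E4 → E6 := fun ξ => p + L ξ + u ξ with hΦ
  set g : M → E4 := fun y => A (f y - p) with hgdef
  -- `g` is `C¹` with `dg = A ∘ df`, injective over the sheet ball
  have hg : ContMDiff (𝓡 4) 𝓘(ℝ, E4) 1 g :=
    ((A.contDiff).comp (contDiff_id.sub contDiff_const)).comp_contMDiff hf
  have hginj : ∀ y, f y ∈ ball p ρ → Function.Injective (mfderiv (𝓡 4) 𝓘(ℝ, E4) g y) := by
    intro y hy
    have hψd : HasFDerivAt (fun z : E6 => A (z - p)) A (f y) := by
      have h := (A.hasFDerivAt (x := f y - p)).comp (f y) ((hasFDerivAt_id (f y)).sub_const p)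
      simpa [Function.comp_def] using h
    have hfd : HasMFDerivAt (𝓡 4) (𝓡 6) f y (mfderiv (𝓡 4) (𝓡 6) f y) :=
      (hf.mdifferentiableAt one_ne_zero).hasMFDerivAt
    have hcomp : mfderiv (𝓡 4) 𝓘(ℝ, E4) g y = A.comp (mfderiv (𝓡 4) (𝓡 6) f y) :=
      (hψd.hasMFDerivAt.comp y hfd).mfderiv
    rw [hcomp]
    exact (sheet_tangent_of_subset hf hinj L horth hdiff hS hy).2
  -- the realised parameters `U = g '' f⁻¹(B(p, ρ))`: open
  set V : Set M := f ⁻¹' ball p ρ with hV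
  have hVo : IsOpen V := hf.continuous.isOpen_preimage _ isOpen_ball
  set U : Set E4 := g '' V with hU
  have hUo : IsOpen U := by
    rw [isOpen_iff_mem_nhds]
    rintro _ ⟨y, hyV, rfl⟩
    exact image_mem_nhds_of_injective_mfderiv hg (hginj y hyV) (hVo.mem_nhds hyV)
  -- … and contained in the parameter region, with `Φ` landing in `range f`
  have hUsub : ∀ ξ ∈ U, ξ ∈ ball (0 : E4) ρ ∧ Φ ξ ∈ ball p ρ ∧ Φ ξ ∈ Set.range f := by
    rintro _ ⟨y, hyV, rfl⟩
    obtain ⟨hξ, hfy⟩ := exists_param_of_subset_sheet L horth hS (mem_range_self y) hyV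
    have hfy' : Φ (g y) = f y := hfy.symm
    exact ⟨hξ, hfy' ▸ hyV, hfy' ▸ mem_range_self y⟩
  -- the parameter region is contained in `U`
  set Ω : Set E4 := {ξ : E4 | ξ ∈ ball (0 : E4) ρ ∧ p + L ξ + u ξ ∈ ball p ρ} with hΩ
  have hΩU : Ω ⊆ U := by
    refine (isPreconnected_sheetDomain hρ L h0 horth hdiff hD).subset_of_closure_inter_subset hUo
      ⟨0, ⟨mem_ball_self hρ, by simp [h0, hρ]⟩, ⟨x, by simp [hV, hp, hρ], by simp [hgdef, hp]⟩⟩ ?_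
    rintro ξ ⟨hξcl, hξΩ⟩
    -- `Φ ξ ∈ closure (Φ '' U) ⊆ range f`
    have hcont : ContinuousAt Φ ξ := by
      have h1 : HasFDerivAt (fun ξ' : E4 => p + L ξ') L.toContinuousLinearMap ξ :=
        (L.toContinuousLinearMap.hasFDerivAt).const_add p
      exact (h1.add (hdiff ξ hξΩ.1).hasFDerivAt).continuousAt
    have hmem : Φ ξ ∈ closure (Φ '' U) := hcont.continuousWithinAt.mem_closure_image hξcl
    have hsub : Φ '' U ⊆ Set.range f := by
      rintro _ ⟨ξ', hξ', rfl⟩; exact (hUsub ξ' hξ').2.2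
    have hclosed : IsClosed (Set.range f) := (isCompact_range hf.continuous).isClosed
    obtain ⟨y, hy⟩ : Φ ξ ∈ Set.range f := (closure_minimal hsub hclosed) hmem
    have hyV : y ∈ V := by
      change f y ∈ ball p ρ
      rw [hy]; exact hξΩ.2
    refine ⟨y, hyV, ?_⟩
    change A (f y - p) = ξ
    rw [hy]
    exact adjoint_apply_sheet L (horth ξ hξΩ.1)
  -- conclusion
  refine Set.Subset.antisymm (fun z hz => ⟨hS hz, hz.2⟩) ?_
  rintro z ⟨⟨ξ, hξ, rfl⟩, hz⟩
  exact ⟨(hUsub ξ (hΩU ⟨hξ, hz⟩)).2.2, hz⟩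

end ContainmentEquality


section ReductionFromGraphs

open Literature.Geometry.Lorentzian Literature.Geometry.Lorentzian.PseudoRiemannianMetric

/-- **`White2005_localRegularity_cylinderFlowSheet` from White's `K_{2,α}` estimate read LITERALLY**
(containment in a graph, as in the definition of `K_{2,α} ≤ 1`, §2.5 p. 1493-4, rather than the
equality of his Remark): the same statement as
`White2005_localRegularity_cylinderFlowSheet_of_sheets` with
`range (F t) ∩ B(F t x, d/C) ⊆ Φ(B(0, d/C))` in the hypothesis; the equality is supplied by
`sheet_eq_of_subset` (star-shapedness of the parameter region + inverse function theorem +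
compactness of `M`). [cite: White2005, Thm. 4.1 and §2.5] -/
theorem White2005_localRegularity_cylinderFlowSheet_of_graphs
    (hcore : ∃ ε : ℝ, 0 < ε ∧ ∃ C : ℝ, 0 < C ∧ ∃ d₀ : ℝ, 0 < d₀ ∧
      ∀ (M : Type) [TopologicalSpace M] [T2Space M] [SecondCountableTopology M]
        [ChartedSpace E4 M] [IsManifold (𝓡 4) ∞ M] [CompactSpace M]
        [ConnectedSpace M]
        (F : ℝ → M → EuclideanSpace ℝ (Fin 6)) (ν : ℝ → M → EuclideanSpace ℝ (Fin 6)) (T : ℝ),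
        (∃ U : Set ℝ, IsOpen U ∧ Set.Ici T ⊆ U ∧
          ContMDiffOn (𝓘(ℝ, ℝ).prod (𝓡 4)) (𝓡 6) ∞ (fun p : ℝ × M => F p.1 p.2) (U ×ˢ Set.univ)) →
        (∀ t, T ≤ t → Manifold.IsSmoothEmbedding (𝓡 4) (𝓡 6) ∞ (F t)) →
        (∀ t, T ≤ t → ∀ x, ∑ i : Fin 5, F t x (Fin.castSucc i) ^ 2 = 1) →
        ∀ himm : ∀ t, T ≤ t →
          (euclideanMetric E6).IsSpacelikeImmersion (𝓡 4) (F t),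
        (∀ t, T ≤ t →
          (euclideanMetric E6).IsUnitNormal (𝓡 4) (F t) (ν t) 1) →
        (∀ t, T ≤ t → ∀ x, ∑ i : Fin 5, ν t x (Fin.castSucc i) * F t x (Fin.castSucc i) = 0) →
        (∀ t, T ≤ t → ContMDiff (𝓡 4) (𝓡 6) ∞ (ν t)) →
        (∀ t (ht : T ≤ t) (x : M), mfderiv 𝓘(ℝ, ℝ) (𝓡 6) (fun s => F s x) t (1 : ℝ) =
          -((euclideanMetric E6).meanCurvature (F t)
              contMDiff_pullbackBilin_holds (himm t ht) (ν t) x) • ν t x) →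
        ∀ t d : ℝ, 0 < d → d ≤ d₀ → T + d ^ 2 ≤ t →
        (∀ (y : EuclideanSpace ℝ (Fin 6)) (s r : ℝ), 0 < r → t - d ^ 2 ≤ s - r ^ 2 →
          s ≤ t + d ^ 2 →
          gaussianArea 4 y (r ^ 2) (Set.range (F (s - r ^ 2))) ≤ ENNReal.ofReal (1 + ε)) →
        ∀ x : M, ∃ (L : E4 →ₗᵢ[ℝ] E6) (u : E4 → E6), u 0 = 0 ∧
          (∀ ξ ∈ ball (0 : E4) (d / C), ∀ η, ⟪u ξ, L η⟫_ℝ = 0) ∧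
          (∀ ξ ∈ ball (0 : E4) (d / C), DifferentiableAt ℝ u ξ) ∧
          (∀ ξ ∈ ball (0 : E4) (d / C), ‖fderiv ℝ u ξ‖ ≤ 1) ∧
          (∀ ξ ∈ ball (0 : E4) (d / C), ∀ ξ' ∈ ball (0 : E4) (d / C),
            ‖fderiv ℝ u ξ - fderiv ℝ u ξ'‖ ≤ C / d * ‖ξ - ξ'‖) ∧
          Set.range (F t) ∩ ball (F t x) (d / C) ⊆
            (fun ξ => F t x + L ξ + u ξ) '' ball (0 : E4) (d / C)) :

    White2005_localRegularity_cylinderFlowSheet := by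
  obtain ⟨ε, hε, C, hC, d₀, hd₀, hcore⟩ := hcore
  refine White2005_localRegularity_cylinderFlowSheet_of_sheets ⟨ε, hε, C, hC, d₀, hd₀, ?_⟩
  intro M _ _ _ _ _ _ _ F ν T hsmooth hemb hN himm hun hνN hνs hmcf t d hd hdd₀ hTt hdens x
  obtain ⟨L, u, h0, horth, hdiff, hD, hD2, hS⟩ :=
    hcore M F ν T hsmooth hemb hN himm hun hνN hνs hmcf t d hd hdd₀ hTt hdens x
  have ht : T ≤ t := by nlinarith only [hTt, sq_nonneg d]
  have hf1 : ContMDiff (𝓡 4) (𝓡 6) 1 (F t) := (himm t ht).contMDiff.of_le le_add_self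
  refine ⟨L, u, h0, horth, hdiff, hD, hD2, ?_⟩
  exact sheet_eq_of_subset hf1 (himm t ht).injective_mfderiv (by positivity) L h0 horth hdiff hD hS

end ReductionFromGraphs

/-! ### Reduction of the fact to White's `K_{2,α}` bound in the tree's `K_{2,α}` vocabulary -/

section ReductionFromK2α

open Literature.Analysis.PDE Literature.Analysis.PDE.Parabolic ParabolicFlow

/-- **A unit graph bound at the dilated top-time point gives a `C^{1,1}` graph at scale `1/c`.**
If `D_c(S - (p, t)) ∩ B^{6,1}` lies on the parabolic graph of `u` over the `4`-plane `L` with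
`‖u‖_{2,α; B^{4,1}} ≤ 1` (`HasUnitGraphBound`, i.e. `c` is a good scale for `K_{2,α}(S; (p,t))`),
`S` contains the time-`t` slice points `(z, t)`, `z ∈ Z ∋ p`, and `c ρ ≤ 1`, then `Z ∩ B(p, ρ)`
lies on the graph `ξ ↦ p + L ξ + u′ ξ`, `u′ ξ = c⁻¹ u(c ξ, 0)`, over `B^4(0, ρ)` with `u′ 0 = 0`,
`u′ ⊥ range L`, `‖Du′‖ ≤ 1` and `Du′` `c`-Lipschitz (mean value inequality for `D u(·, 0)` with
`‖D² u‖ ≤ 1`).  This is the time-slice reading of White's definition of `K_{2,α}` (§2.5).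
[cite: White2005, §2.5] -/
theorem exists_graph_of_hasUnitGraphBound {α : ℝ≥0} {S : Set (Parabolic E6)} {Z : Set E6}
    {p : E6} {t : ℝ} (hZ : ∀ z ∈ Z, (⟨z, t⟩ : Parabolic E6) ∈ S) (hp : p ∈ Z) {c : ℝ}
    (hc : 0 < c) (hG : HasUnitGraphBound 4 α (dilation c '' ((· - (⟨p, t⟩ : Parabolic E6)) '' S)))
    {ρ : ℝ} (hρ : c * ρ ≤ 1) :
    ∃ (L : E4 →ₗᵢ[ℝ] E6) (u : E4 → E6), u 0 = 0 ∧
      (∀ ξ ∈ ball (0 : E4) ρ, ∀ η, ⟪u ξ, L η⟫_ℝ = 0) ∧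
      (∀ ξ ∈ ball (0 : E4) ρ, DifferentiableAt ℝ u ξ) ∧
      (∀ ξ ∈ ball (0 : E4) ρ, ‖fderiv ℝ u ξ‖ ≤ 1) ∧
      (∀ ξ ∈ ball (0 : E4) ρ, ∀ ξ' ∈ ball (0 : E4) ρ,
        ‖fderiv ℝ u ξ - fderiv ℝ u ξ'‖ ≤ c * ‖ξ - ξ'‖) ∧
      Z ∩ ball p ρ ⊆ (fun ξ => p + L ξ + u ξ) '' ball (0 : E4) ρ := by
  obtain ⟨L, u, horth, hn, hsub⟩ := hG
  obtain ⟨hC, hD, -, hD2, -⟩ := bounds_of_c2αNormOn_le_one hn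
  have hc0 : c ≠ 0 := hc.ne'
  have h0t : |(0 : ℝ)| < 1 := by simp
  -- parameters in `B^4(0, ρ)` dilate into the unit ball
  have hsm : ∀ ξ ∈ ball (0 : E4) ρ, c • ξ ∈ ball (0 : E4) 1 := fun ξ hξ => by
    rw [mem_ball_zero_iff] at hξ ⊢
    rw [norm_smul, Real.norm_of_nonneg hc.le]
    nlinarith
  -- the slice `ξ ↦ c⁻¹ u (c ξ, 0)` and its derivative
  set u' : E4 → E6 := fun ξ => c⁻¹ • u ⟨c • ξ, 0⟩ with hu'
  have hderiv : ∀ ξ ∈ ball (0 : E4) ρ, HasFDerivAt u' (spaceDeriv u ⟨c • ξ, 0⟩) ξ := by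
    intro ξ hξ
    have hout : HasFDerivAt (fun x : E4 => u ⟨x, 0⟩) (spaceDeriv u ⟨c • ξ, 0⟩) (c • ξ) :=
      hC.hasFDerivAt_space (mk_mem_ball_of_mem_ball h0t (hsm ξ hξ))
    have hin : HasFDerivAt (fun x : E4 => c • x) (c • ContinuousLinearMap.id ℝ E4) ξ :=
      (hasFDerivAt_id ξ).const_smul c
    have h := (hout.comp ξ hin).const_smul c⁻¹
    refine h.congr_fderiv ?_
    ext v
    simp [smul_smul, inv_mul_cancel₀ hc0]
  -- the derivative slice `x ↦ D u (x, 0)` is `1`-Lipschitz on the unit ball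
  have hLip : ∀ x ∈ ball (0 : E4) 1, ∀ y ∈ ball (0 : E4) 1,
      ‖spaceDeriv u ⟨x, 0⟩ - spaceDeriv u ⟨y, 0⟩‖ ≤ 1 * ‖x - y‖ := fun x hx y hy =>
    (convex_ball (0 : E4) 1).norm_image_sub_le_of_norm_hasFDerivWithin_le
      (f := fun x' => spaceDeriv u ⟨x', 0⟩)
      (fun x' hx' =>
        (hC.hasFDerivAt_spaceDeriv (mk_mem_ball_of_mem_ball h0t hx')).hasFDerivWithinAt)
      (fun x' hx' => hD2 _ (mk_mem_ball_of_mem_ball h0t hx')) hy hx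
  -- the origin lies on the graph, so `u 0 = 0`
  have hu0 : u 0 = 0 := by
    have h0mem : (0 : Parabolic E6) ∈
        dilation c '' ((· - (⟨p, t⟩ : Parabolic E6)) '' S) ∩ ball 0 1 :=
      ⟨⟨_, ⟨_, hZ p hp, rfl⟩, by simp⟩, mem_ball_self one_pos⟩
    obtain ⟨Ξ, -, hΞ⟩ := mem_parabolicGraph.1 (hsub h0mem)
    have hx : L Ξ.x + u Ξ = 0 := congrArg Parabolic.x hΞ
    have ht' : Ξ.t = 0 := congrArg Parabolic.t hΞ
    have hΞx : Ξ.x = 0 := by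
      have h := ParabolicFlow.norm_le_norm_map_add_of_inner_eq_zero (horth Ξ) Ξ.x
      rw [hx, norm_zero, norm_le_zero_iff] at h
      exact h
    have hΞ0 : Ξ = 0 := Parabolic.ext hΞx ht'
    rw [hΞ0, zero_x, map_zero, zero_add] at hx
    exact hx
  refine ⟨L, u', ?_, fun ξ _ η => ?_, fun ξ hξ => (hderiv ξ hξ).differentiableAt,
    fun ξ hξ => ?_, fun ξ hξ ξ' hξ' => ?_, ?_⟩
  · have h00 : (⟨0, 0⟩ : Parabolic E4) = 0 := Parabolic.ext rfl rfl
    show c⁻¹ • u ⟨c • 0, 0⟩ = 0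
    rw [smul_zero, h00, hu0, smul_zero]
  · simp only [hu', real_inner_smul_left, horth, mul_zero]
  · rw [(hderiv ξ hξ).fderiv]
    exact hD _ (mk_mem_ball_of_mem_ball h0t (hsm ξ hξ))
  · rw [(hderiv ξ hξ).fderiv, (hderiv ξ' hξ').fderiv]
    calc ‖spaceDeriv u ⟨c • ξ, 0⟩ - spaceDeriv u ⟨c • ξ', 0⟩‖ ≤ 1 * ‖c • ξ - c • ξ'‖ :=
          hLip _ (hsm ξ hξ) _ (hsm ξ' hξ')
      _ = c * ‖ξ - ξ'‖ := by rw [← smul_sub, norm_smul, Real.norm_of_nonneg hc.le, one_mul]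
  · rintro z ⟨hzZ, hzB⟩
    rw [mem_ball, dist_eq_norm] at hzB
    have hmem : dilation c ((⟨z, t⟩ : Parabolic E6) - ⟨p, t⟩) ∈
        dilation c '' ((· - (⟨p, t⟩ : Parabolic E6)) '' S) ∩ ball 0 1 := by
      refine ⟨⟨_, ⟨_, hZ z hzZ, rfl⟩, rfl⟩, ?_⟩
      rw [mem_ball_zero_one_iff]
      simp only [dilation_x, dilation_t, sub_x, sub_t, sub_self, mul_zero, abs_zero, zero_lt_one,
        and_true, norm_smul, Real.norm_of_nonneg hc.le]
      nlinarith
    obtain ⟨Ξ, hΞB, hΞ⟩ := mem_parabolicGraph.1 (hsub hmem)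
    have hx : L Ξ.x + u Ξ = c • (z - p) := by
      have h := congrArg Parabolic.x hΞ; simpa using h
    have ht' : Ξ.t = 0 := by
      have h := congrArg Parabolic.t hΞ; simpa using h
    have hΞeq : Ξ = ⟨c • (c⁻¹ • Ξ.x), 0⟩ := by
      refine Parabolic.ext ?_ ht'
      simp [smul_smul, mul_inv_cancel₀ hc0]
    refine ⟨c⁻¹ • Ξ.x, ?_, ?_⟩
    · rw [mem_ball_zero_iff, norm_smul, Real.norm_of_nonneg (inv_nonneg.2 hc.le)]
      have h1 : ‖Ξ.x‖ ≤ ‖c • (z - p)‖ := by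
        rw [← hx]; exact ParabolicFlow.norm_le_norm_map_add_of_inner_eq_zero (horth Ξ) Ξ.x
      rw [norm_smul, Real.norm_of_nonneg hc.le] at h1
      calc c⁻¹ * ‖Ξ.x‖ ≤ c⁻¹ * (c * ‖z - p‖) := by gcongr
        _ = ‖z - p‖ := by field_simp
        _ < ρ := hzB
    · show p + L (c⁻¹ • Ξ.x) + c⁻¹ • u ⟨c • (c⁻¹ • Ξ.x), 0⟩ = z
      rw [← hΞeq, L.map_smul, add_assoc, ← smul_add, hx, smul_smul, inv_mul_cancel₀ hc0, one_smul]
      abel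

open Literature.Geometry.Lorentzian Literature.Geometry.Lorentzian.PseudoRiemannianMetric

/-- **Reduction of the fact to White's `K_{2,α}` bound, in the tree's `K_{2,α}` vocabulary.**  IF
there are `ε, C, d₀ > 0` and an exponent `α` such that for every cylinder flow as in the fact and
every admissible `(t, d)` the density hypothesis implies, at every top-time point `X = (F t x, t)`,
`K_{2,α}(𝓜; X) ≤ C / d` for the spacetime track `𝓜` of the flow over the window
`(t - d², t + d²)` (this is White's `K_{2,α}(𝓜; X) · d(X, U) ≤ C`, Thm. 4.1 with Thm. 3.2, for
`U = ℝ⁶ × (t - d², t + d²)`, where `d(X, U) = d`; `K_{2,α}` is `ParabolicFlow.k2α` of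
`FlowC2AlphaNorm.lean`), THEN `White2005_localRegularity_cylinderFlowSheet` holds: a good scale
`c < 2C/d` at `X` is read at time `t` (`exists_graph_of_hasUnitGraphBound`) as ONE graph of
controlled `C^{1,1}` size at scale `d / (2C)`, and `White2005_localRegularity_cylinderFlowSheet_
of_graphs` applies.  This isolates exactly the analytic content of White's theorem that remains to
be formalized. [cite: White2005, Thm. 4.1, Thm. 3.2, §2.5] -/
theorem White2005_localRegularity_cylinderFlowSheet_of_k2α_bound
    (hcore : ∃ ε : ℝ, 0 < ε ∧ ∃ C : ℝ, 0 < C ∧ ∃ d₀ : ℝ, 0 < d₀ ∧ ∃ α : ℝ≥0,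
      ∀ (M : Type) [TopologicalSpace M] [T2Space M] [SecondCountableTopology M]
        [ChartedSpace E4 M] [IsManifold (𝓡 4) ∞ M] [CompactSpace M]
        [ConnectedSpace M]
        (F : ℝ → M → EuclideanSpace ℝ (Fin 6)) (ν : ℝ → M → EuclideanSpace ℝ (Fin 6)) (T : ℝ),
        (∃ U : Set ℝ, IsOpen U ∧ Set.Ici T ⊆ U ∧
          ContMDiffOn (𝓘(ℝ, ℝ).prod (𝓡 4)) (𝓡 6) ∞ (fun p : ℝ × M => F p.1 p.2) (U ×ˢ Set.univ)) →
        (∀ t, T ≤ t → Manifold.IsSmoothEmbedding (𝓡 4) (𝓡 6) ∞ (F t)) →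
        (∀ t, T ≤ t → ∀ x, ∑ i : Fin 5, F t x (Fin.castSucc i) ^ 2 = 1) →
        ∀ himm : ∀ t, T ≤ t →
          (euclideanMetric E6).IsSpacelikeImmersion (𝓡 4) (F t),
        (∀ t, T ≤ t →
          (euclideanMetric E6).IsUnitNormal (𝓡 4) (F t) (ν t) 1) →
        (∀ t, T ≤ t → ∀ x, ∑ i : Fin 5, ν t x (Fin.castSucc i) * F t x (Fin.castSucc i) = 0) →
        (∀ t, T ≤ t → ContMDiff (𝓡 4) (𝓡 6) ∞ (ν t)) →
        (∀ t (ht : T ≤ t) (x : M), mfderiv 𝓘(ℝ, ℝ) (𝓡 6) (fun s => F s x) t (1 : ℝ) =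
          -((euclideanMetric E6).meanCurvature (F t)
              contMDiff_pullbackBilin_holds (himm t ht) (ν t) x) • ν t x) →
        ∀ t d : ℝ, 0 < d → d ≤ d₀ → T + d ^ 2 ≤ t →
        (∀ (y : EuclideanSpace ℝ (Fin 6)) (s r : ℝ), 0 < r → t - d ^ 2 ≤ s - r ^ 2 →
          s ≤ t + d ^ 2 →
          gaussianArea 4 y (r ^ 2) (Set.range (F (s - r ^ 2))) ≤ ENNReal.ofReal (1 + ε)) →
        ∀ x : M, k2α 4 α {Y : Parabolic E6 | ∃ s ∈ Ioo (t - d ^ 2) (t + d ^ 2), ∃ y : M,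
            Y = ⟨F s y, s⟩} ⟨F t x, t⟩ ≤ ENNReal.ofReal (C / d)) :
    White2005_localRegularity_cylinderFlowSheet := by
  obtain ⟨ε, hε, C, hC, d₀, hd₀, α, hcore⟩ := hcore
  refine White2005_localRegularity_cylinderFlowSheet_of_graphs
    ⟨ε, hε, 2 * C, by positivity, d₀, hd₀, ?_⟩
  intro M _ _ _ _ _ _ _ F ν T hsmooth hemb hN himm hun hνN hνs hmcf t d hd hdd₀ hTt hdens x
  have hK := hcore M F ν T hsmooth hemb hN himm hun hνN hνs hmcf t d hd hdd₀ hTt hdens x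
  -- a good scale below `2C/d`
  have hlt : k2α 4 α {Y : Parabolic E6 | ∃ s ∈ Ioo (t - d ^ 2) (t + d ^ 2), ∃ y : M,
      Y = ⟨F s y, s⟩} ⟨F t x, t⟩ < ENNReal.ofReal (2 * C / d) := by
    refine hK.trans_lt ((ENNReal.ofReal_lt_ofReal_iff (by positivity)).2 ?_)
    rw [div_lt_div_iff_of_pos_right hd]; linarith
  simp only [k2α, iInf_lt_iff] at hlt
  obtain ⟨c, hc0, hcg, hcd⟩ := hlt
  have hcd' : c < 2 * C / d := (ENNReal.ofReal_lt_ofReal_iff (by positivity)).1 hcd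
  have hρ : c * (d / (2 * C)) ≤ 1 := by
    rw [lt_div_iff₀ hd] at hcd'
    rw [mul_div_assoc', div_le_one (by positivity)]
    linarith
  have ht : t ∈ Ioo (t - d ^ 2) (t + d ^ 2) := ⟨by nlinarith, by nlinarith⟩
  obtain ⟨L, u, h0, horth, hdiff, hD, hD2, hS⟩ := exists_graph_of_hasUnitGraphBound
    (S := {Y : Parabolic E6 | ∃ s ∈ Ioo (t - d ^ 2) (t + d ^ 2), ∃ y : M, Y = ⟨F s y, s⟩})
    (Z := Set.range (F t)) (fun z ⟨y, hy⟩ => ⟨t, ht, y, by rw [hy]⟩) ⟨x, rfl⟩ hc0 hcg hρ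
  refine ⟨L, u, h0, horth, hdiff, hD, fun ξ hξ ξ' hξ' => (hD2 ξ hξ ξ' hξ').trans ?_, hS⟩
  have h1 : c ≤ 2 * C / d := hcd'.le
  gcongr

end ReductionFromK2α

/-! ### Reduction to White's scale-invariant form `K_{2,α;U}(𝓜) ≤ C` -/

section ReductionFromK2αOn

open Literature.Analysis.PDE Literature.Analysis.PDE.Parabolic ParabolicFlow
open Literature.Geometry.Lorentzian Literature.Geometry.Lorentzian.PseudoRiemannianMetric

/-- **Reduction of the fact to White's scale-invariant bound `K_{2,α;U}(𝓜) ≤ C` (Thm. 4.1 with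
Thm. 3.2, as printed) for the slab `U = ℝ⁶ × (t - d², t + d²)`**: since `d(X, U) = d` at the
top-time points `X = (F t x, t)` (`k2α_le_of_k2αOn_slab_le`), the bound gives
`K_{2,α}(𝓜; X) ≤ C/d` there, and `White2005_localRegularity_cylinderFlowSheet_of_k2α_bound`
applies.  Here `𝓜` is the spacetime track of the flow over the window and `K_{2,α;U}` is
`ParabolicFlow.k2αOn` (`FlowC2AlphaNorm.lean`). [cite: White2005, Thm. 4.1, Thm. 3.2, §2.6] -/
theorem White2005_localRegularity_cylinderFlowSheet_of_k2αOn_bound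
    (hcore : ∃ ε : ℝ, 0 < ε ∧ ∃ C : ℝ, 0 < C ∧ ∃ d₀ : ℝ, 0 < d₀ ∧ ∃ α : ℝ≥0,
      ∀ (M : Type) [TopologicalSpace M] [T2Space M] [SecondCountableTopology M]
        [ChartedSpace E4 M] [IsManifold (𝓡 4) ∞ M] [CompactSpace M]
        [ConnectedSpace M]
        (F : ℝ → M → EuclideanSpace ℝ (Fin 6)) (ν : ℝ → M → EuclideanSpace ℝ (Fin 6)) (T : ℝ),
        (∃ U : Set ℝ, IsOpen U ∧ Set.Ici T ⊆ U ∧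
          ContMDiffOn (𝓘(ℝ, ℝ).prod (𝓡 4)) (𝓡 6) ∞ (fun p : ℝ × M => F p.1 p.2) (U ×ˢ Set.univ)) →
        (∀ t, T ≤ t → Manifold.IsSmoothEmbedding (𝓡 4) (𝓡 6) ∞ (F t)) →
        (∀ t, T ≤ t → ∀ x, ∑ i : Fin 5, F t x (Fin.castSucc i) ^ 2 = 1) →
        ∀ himm : ∀ t, T ≤ t →
          (euclideanMetric E6).IsSpacelikeImmersion (𝓡 4) (F t),
        (∀ t, T ≤ t →
          (euclideanMetric E6).IsUnitNormal (𝓡 4) (F t) (ν t) 1) →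
        (∀ t, T ≤ t → ∀ x, ∑ i : Fin 5, ν t x (Fin.castSucc i) * F t x (Fin.castSucc i) = 0) →
        (∀ t, T ≤ t → ContMDiff (𝓡 4) (𝓡 6) ∞ (ν t)) →
        (∀ t (ht : T ≤ t) (x : M), mfderiv 𝓘(ℝ, ℝ) (𝓡 6) (fun s => F s x) t (1 : ℝ) =
          -((euclideanMetric E6).meanCurvature (F t)
              contMDiff_pullbackBilin_holds (himm t ht) (ν t) x) • ν t x) →
        ∀ t d : ℝ, 0 < d → d ≤ d₀ → T + d ^ 2 ≤ t →
        (∀ (y : EuclideanSpace ℝ (Fin 6)) (s r : ℝ), 0 < r → t - d ^ 2 ≤ s - r ^ 2 →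
          s ≤ t + d ^ 2 →
          gaussianArea 4 y (r ^ 2) (Set.range (F (s - r ^ 2))) ≤ ENNReal.ofReal (1 + ε)) →
        k2αOn 4 α {Y : Parabolic E6 | ∃ s ∈ Ioo (t - d ^ 2) (t + d ^ 2), ∃ y : M, Y = ⟨F s y, s⟩}
          {Y : Parabolic E6 | Y.t ∈ Ioo (t - d ^ 2) (t + d ^ 2)} ≤ ENNReal.ofReal C) :
    White2005_localRegularity_cylinderFlowSheet := by
  obtain ⟨ε, hε, C, hC, d₀, hd₀, α, hcore⟩ := hcore
  refine White2005_localRegularity_cylinderFlowSheet_of_k2α_bound ⟨ε, hε, C, hC, d₀, hd₀, α, ?_⟩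
  intro M _ _ _ _ _ _ _ F ν T hsmooth hemb hN himm hun hνN hνs hmcf t d hd hdd₀ hTt hdens x
  have hK := hcore M F ν T hsmooth hemb hN himm hun hνN hνs hmcf t d hd hdd₀ hTt hdens
  have ht : t ∈ Ioo (t - d ^ 2) (t + d ^ 2) := ⟨by nlinarith, by nlinarith⟩
  exact k2α_le_of_k2αOn_slab_le hd hK ⟨t, ht, x, rfl⟩ rfl

end ReductionFromK2αOn

/-! ### The remaining core in White's own form (density ratios `Θ`, `K_{2,α;U}`) -/

section WhiteForm

open Literature.Analysis.PDE Literature.Analysis.PDE.Parabolic ParabolicFlow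

/-- **The fact's density hypothesis in White's form.**  If the Euclidean Gaussian density ratios
`gaussianArea 4 y (r²) (range (F (s - r²)))` are `≤ 1 + ε` for all centres `y`, all `s ≤ t + d²`
and all `r > 0` with `t - d² ≤ s - r²` (the hypothesis of
`White2005_localRegularity_cylinderFlowSheet`), then White's hypothesis of Thm. 3.1/4.1 holds for
the spacetime track `𝓜` of `F` over the slab `U = ℝ⁶ × (t - d², t + d²)`:
`Θ(𝓜, Y, r) ≤ 1 + ε` for all `Y ∈ U` and `0 < r < d(Y, U)` (White's `Θ` is
`ParabolicFlow.gaussianDensityRatio`, `d(Y, U)` is `ParabolicFlow.edistCompl`).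
[cite: White2005, Thm. 3.1, Thm. 4.1, §2.9] -/
theorem gaussianDensityRatio_track_le_of_densityHypothesis {M : Type*} (F : ℝ → M → E6)
    {t d ε : ℝ}
    (hdens : ∀ (y : E6) (s r : ℝ), 0 < r → t - d ^ 2 ≤ s - r ^ 2 → s ≤ t + d ^ 2 →
      gaussianArea 4 y (r ^ 2) (Set.range (F (s - r ^ 2))) ≤ ENNReal.ofReal (1 + ε))
    {Y : Parabolic E6} (hY : Y ∈ {Y : Parabolic E6 | Y.t ∈ Ioo (t - d ^ 2) (t + d ^ 2)}) {r : ℝ}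
    (hr : 0 < r)
    (hrY : ENNReal.ofReal r < edistCompl Y {Y : Parabolic E6 | Y.t ∈ Ioo (t - d ^ 2) (t + d ^ 2)}) :
    gaussianDensityRatio 4 {Z : Parabolic E6 | ∃ s ∈ Ioo (t - d ^ 2) (t + d ^ 2), ∃ y : M,
        Z = ⟨F s y, s⟩} Y r ≤ ENNReal.ofReal (1 + ε) := by
  simp only [mem_setOf_eq, mem_Ioo] at hY
  -- `r < d(Y, U)` forces `t - d² < Y.t - r²`: the point below `Y` at time `t - d²` is outside `U`
  have hslice : t - d ^ 2 < Y.t - r ^ 2 := by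
    refine lt_of_not_ge fun hle => ?_
    have hmem : (⟨Y.x, t - d ^ 2⟩ : Parabolic E6) ∈
        {Y : Parabolic E6 | Y.t ∈ Ioo (t - d ^ 2) (t + d ^ 2)}ᶜ := by simp
    have h1 : edistCompl Y {Y : Parabolic E6 | Y.t ∈ Ioo (t - d ^ 2) (t + d ^ 2)} ≤
        edist Y (⟨Y.x, t - d ^ 2⟩ : Parabolic E6) := Metric.infEDist_le_edist_of_mem hmem
    have h2 : edist Y (⟨Y.x, t - d ^ 2⟩ : Parabolic E6) ≤ ENNReal.ofReal r := by
      rw [edist_dist, Parabolic.dist_eq]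
      refine ENNReal.ofReal_le_ofReal (max_le (by simp [hr.le]) ?_)
      rw [Real.sqrt_le_left hr.le, Real.dist_eq, abs_of_nonneg (by linarith)]
      have : Y.t - r ^ 2 ≤ t - d ^ 2 := hle
      linarith
    exact (hrY.trans_le (h1.trans h2)).false
  rw [gaussianDensityRatio_track 4 F (Ioo (t - d ^ 2) (t + d ^ 2)) ⟨hslice, by nlinarith⟩]
  exact hdens Y.x Y.t r hr hslice.le hY.2.le

open Literature.Geometry.Lorentzian Literature.Geometry.Lorentzian.PseudoRiemannianMetric

/-- **The remaining core in White's own form.**  IF White's Theorem 4.1 (with Thm. 3.2 for the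
threshold `ε̄`) holds for the spacetime tracks of cylinder flows in slabs, stated verbatim in the
tree's vocabulary — density ratios `Θ(𝓜, Y, r) ≤ 1 + ε` for `Y ∈ U`, `0 < r < d(Y, U)` imply
`K_{2,α;U}(𝓜) ≤ C` (the forcing term of the cylinder flow in `ℝ⁶` has scale-invariant norm
`‖β‖_{0,α;U} ≤ C′ d ≤ C′ d₀`, absorbed into `C` for `d ≤ d₀`) — THEN the fact
`White2005_localRegularity_cylinderFlowSheet` holds (`gaussianDensityRatio_track_le_of_
densityHypothesis` + `White2005_localRegularity_cylinderFlowSheet_of_k2αOn_bound`).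
[cite: White2005, Thm. 4.1, Thm. 3.2] -/
theorem White2005_localRegularity_cylinderFlowSheet_of_whiteForm
    (hcore : ∃ ε : ℝ, 0 < ε ∧ ∃ C : ℝ, 0 < C ∧ ∃ d₀ : ℝ, 0 < d₀ ∧ ∃ α : ℝ≥0,
      ∀ (M : Type) [TopologicalSpace M] [T2Space M] [SecondCountableTopology M]
        [ChartedSpace E4 M] [IsManifold (𝓡 4) ∞ M] [CompactSpace M]
        [ConnectedSpace M]
        (F : ℝ → M → EuclideanSpace ℝ (Fin 6)) (ν : ℝ → M → EuclideanSpace ℝ (Fin 6)) (T : ℝ),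
        (∃ U : Set ℝ, IsOpen U ∧ Set.Ici T ⊆ U ∧
          ContMDiffOn (𝓘(ℝ, ℝ).prod (𝓡 4)) (𝓡 6) ∞ (fun p : ℝ × M => F p.1 p.2) (U ×ˢ Set.univ)) →
        (∀ t, T ≤ t → Manifold.IsSmoothEmbedding (𝓡 4) (𝓡 6) ∞ (F t)) →
        (∀ t, T ≤ t → ∀ x, ∑ i : Fin 5, F t x (Fin.castSucc i) ^ 2 = 1) →
        ∀ himm : ∀ t, T ≤ t →
          (euclideanMetric E6).IsSpacelikeImmersion (𝓡 4) (F t),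
        (∀ t, T ≤ t →
          (euclideanMetric E6).IsUnitNormal (𝓡 4) (F t) (ν t) 1) →
        (∀ t, T ≤ t → ∀ x, ∑ i : Fin 5, ν t x (Fin.castSucc i) * F t x (Fin.castSucc i) = 0) →
        (∀ t, T ≤ t → ContMDiff (𝓡 4) (𝓡 6) ∞ (ν t)) →
        (∀ t (ht : T ≤ t) (x : M), mfderiv 𝓘(ℝ, ℝ) (𝓡 6) (fun s => F s x) t (1 : ℝ) =
          -((euclideanMetric E6).meanCurvature (F t)
              contMDiff_pullbackBilin_holds (himm t ht) (ν t) x) • ν t x) →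
        ∀ t d : ℝ, 0 < d → d ≤ d₀ → T + d ^ 2 ≤ t →
        (∀ Y ∈ {Y : Parabolic E6 | Y.t ∈ Ioo (t - d ^ 2) (t + d ^ 2)}, ∀ r : ℝ, 0 < r →
          ENNReal.ofReal r < edistCompl Y {Y : Parabolic E6 | Y.t ∈ Ioo (t - d ^ 2) (t + d ^ 2)} →
          gaussianDensityRatio 4 {Z : Parabolic E6 | ∃ s ∈ Ioo (t - d ^ 2) (t + d ^ 2), ∃ y : M,
            Z = ⟨F s y, s⟩} Y r ≤ ENNReal.ofReal (1 + ε)) →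
        k2αOn 4 α {Y : Parabolic E6 | ∃ s ∈ Ioo (t - d ^ 2) (t + d ^ 2), ∃ y : M, Y = ⟨F s y, s⟩}
          {Y : Parabolic E6 | Y.t ∈ Ioo (t - d ^ 2) (t + d ^ 2)} ≤ ENNReal.ofReal C) :
    White2005_localRegularity_cylinderFlowSheet := by
  obtain ⟨ε, hε, C, hC, d₀, hd₀, α, hcore⟩ := hcore
  refine White2005_localRegularity_cylinderFlowSheet_of_k2αOn_bound ⟨ε, hε, C, hC, d₀, hd₀, α, ?_⟩
  intro M _ _ _ _ _ _ _ F ν T hsmooth hemb hN himm hun hνN hνs hmcf t d hd hdd₀ hTt hdens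
  exact hcore M F ν T hsmooth hemb hN himm hun hνN hνs hmcf t d hd hdd₀ hTt
    fun Y hY r hr hrY => gaussianDensityRatio_track_le_of_densityHypothesis F hdens hY hr hrY

end WhiteForm

end Literature.Geometry.Riemannian

end
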